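import Literature.NumberTheory.GaloisRepresentations.ArtinRepresentation
import Literature.NumberTheory.GaloisRepresentations.ArtinConductorIntegralityProofs
import Literature.NumberTheory.GaloisRepresentations.RamificationFiltrationTowerProofs
import Literature.NumberTheory.GaloisRepresentations.TameInertiaProofs
import Mathlib.RingTheory.Jacobson.Ring
import Mathlib.FieldTheory.IsAlgClosed.Basic
import Mathlib.Analysis.Complex.Polynomial.Basic
import Mathlib.Algebra.Group.Shrink
import Mathlib.Algebra.Algebra.ZMod
import Mathlib.Algebra.Module.Torsion.Field
import Mathlib.FieldTheory.Finite.Basic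
import Mathlib.Data.Countable.Small
import HarnessLib

/-!
# Artin's integrality theorem for the inertia group: the proof from named facts
(trunk GalRep, item C10; discharges for `ArtinRepresentation.lean` / `ArtinConductorIntegrality.lean`)

Theorems only (no new definitions, no `sorry`).  Main results:

* `Literature.NumberTheory.GaloisRepresentations.exists_natCast_eq_artinExponent_of` — the named fact
  `Literature.NumberTheory.GaloisRepresentations.exists_natCast_eq_artinExponent` of `ArtinConductorIntegrality` (**Artin's theorem**
  `f(τ) = Σ_i (g_i/g_0) codim M^{G_i} ∈ ℕ` for a representation `τ` of the inertia group
  `G_0 = I(𝔓_E)` of a finite normal `E/K`, `K` a number field, over *any* field `A` with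
  `(q_v : A) ≠ 0`; Serre, *Local Fields*, VI §2 Thm 1' with Cor. 1'; Katz, Prop. 1.9) follows from
  four named facts of the printed theory: Brauer's induction theorem
  (`Literature.RepresentationTheory.FiniteGroups.brauer_induction`, *LinRep* §10 Thm 20), the integrality of the exponent of the
  different of a subextension (`Literature.NumberTheory.GaloisRepresentations.card_inf_inertia_dvd_finsum_lowerIndex`, IV §1 Cor. to
  Prop. 4), the integrality of `f(χ)` for characters of degree one
  (`Literature.NumberTheory.GaloisRepresentations.card_inf_inertia_dvd_finsum_card_inf_ramificationSubgroup`, VI §2 Cor. to Prop. 5, i.e.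
  the Hasse–Arf theorem), and — used only for coefficient fields of characteristic `ℓ > 0` —
  Artin's theorem over *finite* coefficient fields (`Literature.NumberTheory.GaloisRepresentations.exists_natCast_eq_artinExponent_finiteField`,
  Katz 1.9 with `A = 𝔽_λ`, *LinRep* 19.3); for a coefficient field of characteristic `0` the last
  input is not needed (`Literature.NumberTheory.GaloisRepresentations.exists_natCast_eq_artinExponent_of_charZero`);
* `Literature.NumberTheory.GaloisRepresentations.GaloisRep.exists_natCast_eq_artinConductorAt_of_hasOpenInertiaKerAt_of_brauer`
  (and `…_of_brauer_charZero`) — hence the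
  corrected Artin–Katz integrality statement
  `Literature.NumberTheory.GaloisRepresentations.GaloisRep.exists_natCast_eq_artinConductorAt_of_hasOpenInertiaKerAt` of `ArtinConductor.lean`
  (the faithful form of the mis-stated `exists_natCast_eq_artinConductorAt` [Katz1988, Prop. 1.9])
  follows from these four facts together with Herbrand's theorem at the finite layers
  (`herbrand_quotient`), by `ArtinConductorIntegralityProofs`.

The proof is Serre's (VI §2, pp. 99–103), written in "numerator form" (`g_0 · f`, no divisions)
for an abstract finite group `Γ` with a weight `ι : Γ → ℕ` (`Literature.NumberTheory.GaloisRepresentations.artinSum`):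

* `Literature.NumberTheory.GaloisRepresentations.artinSum_eq_sum_sum_filter` (Prop. 2 / Cor. 1: double counting),
  `Literature.NumberTheory.GaloisRepresentations.sum_filter_trace_eq_card_mul_finrank` (`Σ_{s ∈ P} Tr τ(s) = |P| dim V^P`, the averaging
  projector), `Literature.NumberTheory.GaloisRepresentations.artinSum_trace_eq_natCast_sum` (Cor. 1': `g_0 f(χ_V) = Σ_i g_i codim V^{G_i}`),
  `Literature.NumberTheory.GaloisRepresentations.artinSum_degreeOne_eq_natCast_sum` (Prop. 5: `h_0 f(θ) = Σ_{i : H_i ⊄ ker θ} h_i` for `θ` of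
  degree one), `Literature.NumberTheory.GaloisRepresentations.artinSum_indClassFun` (Prop. 4 and Cor.: the induction formula
  `g_0 f(Ind θ) = (Γ : H)(θ(1) Σ_{s ∉ H} i(s) + h_0 f_H(θ))` for Frobenius-induced class functions
  `Literature.RepresentationTheory.FiniteGroups.indClassFun`), and the combinatorial core
  `Literature.NumberTheory.GaloisRepresentations.card_dvd_sum_card_mul_codimFixed_of_brauer` (proof of Thm 1': `|Γ| ∣ Σ_i g_i codim V^{G_i}`
  for every complex representation, from (D), (HA) and Brauer);
* the change of coefficients ("Lefschetz principle"): `Literature.NumberTheory.GaloisRepresentations.exists_matrix_model` (a representation of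
  a finite group over a field `A` is given by matrices over a finitely generated subalgebra `A₀`,
  and for every ring homomorphism `A₀ → k` to a field the dimensions of the fixed spaces of the
  subgroups `P` with `|P| ≠ 0` in `A` are preserved — read off from the characteristic polynomial
  of the averaging idempotent, `Literature.NumberTheory.GaloisRepresentations.charpoly_eq_of_isProj`,
  `Literature.NumberTheory.GaloisRepresentations.finrank_fixedSubmodule_eq_rootMultiplicity`), `Literature.NumberTheory.GaloisRepresentations.nonempty_ringHom_complex` and
  `Literature.NumberTheory.GaloisRepresentations.exists_ringHom_finite` (Zariski's lemma: `A₀` maps to `ℂ` in characteristic `0` and to a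
  finite field in characteristic `ℓ`);
* the number-theoretic instantiation: `Literature.NumberTheory.GaloisRepresentations.artinExponent_eq_sum_div` (`f(τ) = T/g_0` with
  `T = Σ_{i<N} g_i codim M^{G_i}` once `G_i = 1` for `i ≥ N`), the pull-backs
  `Literature.NumberTheory.GaloisRepresentations.lowerIndex_toNat_eq_card_filter` (`i_G(s)` as a count), `Literature.NumberTheory.GaloisRepresentations.card_dvd_sum_lowerIndex_of`, `Literature.NumberTheory.GaloisRepresentations.card_dvd_sum_card_of` of the facts (D), (HA) along
  `Shrink G_0 ≅ G_0 ≤ G` (Brauer's theorem is vendored for groups in `Type`),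
  `Literature.NumberTheory.GaloisRepresentations.card_inertia_dvd_sum_of_brauer` (the characteristic-`0` heart),
  `Literature.NumberTheory.GaloisRepresentations.exists_natCast_eq_artinExponent_core` (generic Dedekind level, any maximal ideal of
  `integralClosure R L`; the `i = 0` term is a multiple of `g_0` and the `G_i`, `i ≥ 1`, are
  `p`-groups, `Ideal.isPGroup_ramificationSubgroup_one`, so their fixed spaces survive the change
  of coefficients), and the number-field case `Literature.NumberTheory.GaloisRepresentations.exists_natCast_eq_artinExponent_of`
  (`q_v = p^f`).

## Mathlib search

Used: `Representation.isProj_averageMap`, `LinearMap.IsProj.trace`, `LinearMap.IsProj.eq_conj_prodMap`,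
`LinearMap.charpoly_toMatrix`, `LinearMap.charpoly_prodMap`, `LinearEquiv.charpoly_conj`,
`Matrix.charpoly_map`, `Polynomial.rootMultiplicity_X_sub_C_pow`, `sum_hom_units`,
`finite_of_finite_type_of_isJacobsonRing` (Zariski's lemma), `IsAlgClosed.lift`,
`Shrink.mulEquiv`, `Countable.toSmall`, `IsPGroup.exists_card_eq`, `FiniteField.card`.  Mathlib has
no Artin character, conductor exponent or Brauer induction theorem; the tree's `Literature` facts
used as hypotheses are listed above (D-0014: threaded, never assumed).

## References

* J.-P. Serre, *Local Fields*, GTM 67 (1979), Ch. IV §1 (Props. 1–4 and Cor.), §2 Cor. 3 to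
  Prop. 7, §3; Ch. VI §1 (Brauer's theorem), §2 (Props. 1–5 and corollaries, Thms 1, 1', proof
  p. 103), §3. [SerreLocalFields1979]
* J.-P. Serre, *Linear Representations of Finite Groups*, GTM 42 (1977), §2.3, §7.2, §10.5
  Thm 20, §19.3. [SerreLinearRepresentations1977]
* N. M. Katz, *Gauss Sums, Kloosterman Sums, and Monodromy Groups* (1988), Ch. 1, Prop. 1.9 and
  its proof. [Katz1988]
-/

noncomputable section

/-! ## Engine: Serre VI §2 Props. 2, 4, 5 in numerator form, for an abstract filtered group -/

namespace Literature.NumberTheory.GaloisRepresentations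

open Finset Module

section EngineGeneral

variable {Γ : Type*} [Group Γ] [Fintype Γ]

/-- `artinSum ι 0 = 0`. [folklore] -/
theorem artinSum_zero {A : Type*} [CommRing A] (ι : Γ → ℕ) : artinSum ι (0 : Γ → A) = 0 := by
  simp [artinSum_def]

/-- `artinSum ι` commutes with finite sums of functions (linearity of `f`, VI §2).
[cite: SerreLocalFields1979, Ch. VI §2, f(φ) = (φ, a_G)] -/
theorem artinSum_finset_sum {A : Type*} [CommRing A] (ι : Γ → ℕ) {κ : Type*} (s : Finset κ)
    (f : κ → Γ → A) : artinSum ι (∑ k ∈ s, f k) = ∑ k ∈ s, artinSum ι (f k) := by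
  classical
  induction s using Finset.induction_on with
  | empty => simp [artinSum_zero]
  | insert a s ha ih => rw [Finset.sum_insert ha, Finset.sum_insert ha, artinSum_add, ih]

/-- **Cor. 1 to Prop. 2 in numerator form (the double-counting step).**  If `ι(s)` counts the
indices `i < N` with `s ∈ F_i` (for `s ≠ 1`), then
`Σ_s ι(s)(φ(1) − φ(s)) = Σ_{i<N} Σ_{s ∈ F_i} (φ(1) − φ(s))`.
Ref: Serre, *Local Fields*, Ch. VI §2, Prop. 2 and Cor. 1 (`f(φ) = Σ (g_i/g_0)(φ(1) − φ(G_i))`).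
[cite: SerreLocalFields1979, Ch. VI §2, Prop. 2 and Cor. 1] -/
theorem artinSum_eq_sum_sum_filter {A : Type*} [CommRing A] (F : ℕ → Subgroup Γ) (N : ℕ)
    (ι : Γ → ℕ) [∀ i, DecidablePred (· ∈ F i)]
    (hι : ∀ s, s ≠ 1 → ι s = ((range N).filter fun i => s ∈ F i).card) (φ : Γ → A) :
    artinSum ι φ = ∑ i ∈ range N, ∑ s ∈ univ.filter (· ∈ F i), (φ 1 - φ s) := by
  have key : ∀ s, (ι s : A) * (φ 1 - φ s) =
      ∑ i ∈ range N, if s ∈ F i then (φ 1 - φ s) else 0 := by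
    intro s
    by_cases hs : s = 1
    · subst hs
      simp
    · rw [hι s hs, Finset.sum_ite, Finset.sum_const_zero, add_zero, Finset.sum_const, nsmul_eq_mul]
  rw [artinSum_def]
  simp_rw [key]
  rw [Finset.sum_comm]
  refine Finset.sum_congr rfl fun i _ => ?_
  rw [Finset.sum_filter]

/-- **`Σ_{s ∈ P} Tr(τ(s)) = |P| · dim V^P`** for a subgroup `P` of a finite group acting on a
finite-dimensional vector space over a field in which `|P| ≠ 0` (trace of the averaging projector,
Mathlib `Representation.isProj_averageMap` and `LinearMap.IsProj.trace`).
Ref: Serre, *Local Fields*, Ch. VI §2, Cor. 1' ("`χ(G_i) = dim V^{G_i}`"); Serre, *Linear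
Representations*, §2.3. [cite: SerreLocalFields1979, Ch. VI §2, Cor. 1' to Prop. 2] -/
theorem sum_filter_trace_eq_card_mul_finrank {k V : Type*} [Field k] [AddCommGroup V] [Module k V]
    [FiniteDimensional k V] (τ : Representation k Γ V) (P : Subgroup Γ) [DecidablePred (· ∈ P)]
    (hP : (Nat.card P : k) ≠ 0) :
    ∑ s ∈ univ.filter (· ∈ P), LinearMap.trace k V (τ s) =
      (Nat.card P : k) * finrank k (Representation.fixedSubmodule τ P) := by
  have hcard : (Fintype.card P : k) = Nat.card P := by rw [Nat.card_eq_fintype_card]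
  letI : Invertible (Fintype.card P : k) := invertibleOfNonzero (by rwa [hcard])
  have h := (Representation.isProj_averageMap (τ.comp P.subtype)).trace
  have h2 : LinearMap.trace k V (Representation.averageMap (τ.comp P.subtype)) =
      ⅟(Fintype.card P : k) * ∑ s : P, LinearMap.trace k V (τ s) := by
    simp only [Representation.averageMap, GroupAlgebra.average, map_smul, map_sum,
      Representation.asAlgebraHom_of, MonoidHom.coe_comp, Function.comp_apply,
      Subgroup.coe_subtype, smul_eq_mul]
  have h3 : ∑ s : P, LinearMap.trace k V (τ s) =
      (Fintype.card P : k) * finrank k (Representation.fixedSubmodule τ P) := by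
    rw [Representation.fixedSubmodule, ← h, h2, ← mul_assoc, mul_invOf_self, one_mul]
  rw [← hcard, ← h3]
  exact Finset.sum_subtype _ (fun s => by simp) _

/-- The number of elements of `Γ` in a subgroup `P`, as a filtered `Finset`, is `|P|`. [folklore] -/
theorem card_filter_mem_subgroup (P : Subgroup Γ) [DecidablePred (· ∈ P)] :
    (univ.filter (· ∈ P)).card = Nat.card P := by
  rw [Nat.card_eq_fintype_card]
  exact (Fintype.card_of_subtype (univ.filter (· ∈ P)) (fun s => by simp)).symm

/-- **Cor. 1' to Prop. 2 in numerator form**: for a representation `τ` of `Γ` on `V` over a field in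
which the `|F_i|`, `i < N`, are non-zero,
`Σ_s ι(s)(χ(1) − χ(s)) = Σ_{i<N} |F_i| · codim V^{F_i}` (`χ = Tr ∘ τ`).
Ref: Serre, *Local Fields*, Ch. VI §2, Cor. 1' to Prop. 2 (`f(χ) = Σ (g_i/g_0) codim V^{G_i}`).
[cite: SerreLocalFields1979, Ch. VI §2, Cor. 1' to Prop. 2] -/
theorem artinSum_trace_eq_natCast_sum {k V : Type*} [Field k] [AddCommGroup V] [Module k V]
    [FiniteDimensional k V] (F : ℕ → Subgroup Γ) (N : ℕ) (ι : Γ → ℕ)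
    [∀ i, DecidablePred (· ∈ F i)]
    (hι : ∀ s, s ≠ 1 → ι s = ((range N).filter fun i => s ∈ F i).card)
    (τ : Representation k Γ V) (hk : ∀ i ∈ range N, (Nat.card (F i) : k) ≠ 0) :
    artinSum ι (fun s => LinearMap.trace k V (τ s)) =
      ((∑ i ∈ range N, Nat.card (F i) * Representation.codimFixed τ (F i) : ℕ) : k) := by
  rw [artinSum_eq_sum_sum_filter F N ι hι, Nat.cast_sum]
  refine Finset.sum_congr rfl fun i hi => ?_
  rw [Finset.sum_sub_distrib, Finset.sum_const, card_filter_mem_subgroup, nsmul_eq_mul, map_one,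
    LinearMap.trace_one, sum_filter_trace_eq_card_mul_finrank τ (F i) (hk i hi), Nat.cast_mul,
    Representation.codimFixed_eq_finrank_sub, Nat.cast_sub (Submodule.finrank_le _), mul_sub]

open scoped Classical in
/-- **Prop. 5 in numerator form**: for a character `θ` of degree one of a subgroup `H`, with the
induced filtration `H_i = H ∩ F_i`, `Σ_{h ∈ H} ι(h)(1 − θ(h)) = Σ_{i<N, H_i ⊄ ker θ} |H_i|`
(a non-trivial character of a finite group sums to zero, Mathlib `sum_hom_units`).
Ref: Serre, *Local Fields*, Ch. VI §2, Prop. 5 ("if `i ≤ c_χ` then `χ(G_i) = 0` … if `i > c_χ`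
then `χ(G_i) = 1`", `f(χ) = Σ_{i=0}^{c_χ} g_i/g_0`). [cite: SerreLocalFields1979, Ch. VI §2, Prop. 5] -/
theorem artinSum_degreeOne_eq_natCast_sum (F : ℕ → Subgroup Γ) (N : ℕ) (ι : Γ → ℕ)
    [∀ i, DecidablePred (· ∈ F i)]
    (hι : ∀ s, s ≠ 1 → ι s = ((range N).filter fun i => s ∈ F i).card)
    (H : Subgroup Γ) [DecidablePred (· ∈ H)] (θ : H →* ℂˣ) :
    artinSum (fun h : H => ι h) (fun h => (θ h : ℂ)) =
      ((∑ i ∈ range N, if (H ⊓ F i).subgroupOf H ≤ θ.ker then 0 else Nat.card ↥(H ⊓ F i) : ℕ) :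
        ℂ) := by
  classical
  have hι' : ∀ h : H, h ≠ 1 → ι h = ((range N).filter fun i => h ∈ (F i).subgroupOf H).card := by
    intro h hh
    rw [hι h fun h1 => hh (Subtype.ext h1)]
    congr 1
    exact Finset.filter_congr fun i _ => by rw [Subgroup.mem_subgroupOf]
  rw [artinSum_eq_sum_sum_filter (fun i => (F i).subgroupOf H) N _ hι', Nat.cast_sum]
  refine Finset.sum_congr rfl fun i _ => ?_
  set P : Subgroup H := (F i).subgroupOf H with hP
  have hPe : (H ⊓ F i).subgroupOf H = P := Subgroup.inf_subgroupOf_left (F i) H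
  have hcardP : Nat.card ↥(H ⊓ F i) = Nat.card P :=
    (Nat.card_congr (Subgroup.subgroupOfEquivOfLe (inf_le_left : H ⊓ F i ≤ H)).toEquiv).symm.trans
      (by rw [hPe])
  have hsum : ∑ h ∈ univ.filter (· ∈ P), (θ h : ℂ) = if P ≤ θ.ker then (Nat.card P : ℂ) else 0 := by
    rw [Finset.sum_subtype (univ.filter (· ∈ P)) (p := (· ∈ P)) (fun s => by simp)]
    set f : P →* ℂ := (Units.coeHom ℂ).comp (θ.comp P.subtype) with hf
    have h1 := sum_hom_units f
    have hf' : ∀ g : P, f g = (θ g : ℂ) := fun g => rfl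
    simp only [hf'] at h1
    rw [h1, Nat.card_eq_fintype_card]
    have hiff : f = 1 ↔ P ≤ θ.ker := by
      constructor
      · intro h1 g hg
        rw [MonoidHom.mem_ker]
        have h2 : f ⟨g, hg⟩ = 1 := by rw [h1, MonoidHom.one_apply]
        rw [hf'] at h2
        exact Units.val_eq_one.mp h2
      · intro hle
        ext g
        rw [hf', MonoidHom.one_apply, Units.val_eq_one]
        exact hle g.2
    by_cases hle : P ≤ θ.ker
    · rw [if_pos (hiff.mpr hle), if_pos hle]
    · rw [if_neg (fun h1 => hle (hiff.mp h1)), if_neg hle, Nat.cast_zero]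
  rw [Finset.sum_sub_distrib, Finset.sum_const, card_filter_mem_subgroup, nsmul_eq_mul, map_one,
    Units.val_one, mul_one, hsum, hPe, hcardP]
  by_cases hle : P ≤ θ.ker
  · simp [hle]
  · simp [hle]

end EngineGeneral

section EngineComplex

variable {Γ : Type} [Group Γ] [Fintype Γ]

/-- **Prop. 4 and its Corollary in numerator form (the induction formula)**: for a subgroup `H`,
a function `θ` on `H` and its induced class function `Ind θ` (Frobenius formula,
`Literature.RepresentationTheory.FiniteGroups.indClassFun`), and a weight `ι` invariant under conjugation,
`Σ_s ι(s)(Ind θ (1) − Ind θ (s)) = |H|⁻¹ |Γ| · (θ(1) Σ_{s ∉ H} ι(s) + Σ_{h ∈ H} ι(h)(θ(1) − θ(h)))`,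
i.e. `f(θ^*) = λ θ(1) + f_H(θ)` with `λ |H| = Σ_{s ∉ H} i_G(s)` (the valuation of the different of
`K'/K`, IV §1 Cor. to Prop. 4) once `ι = i_G` on `G = G_0`.
Ref: Serre, *Local Fields*, Ch. VI §2, Prop. 4 and Corollary (`f(ψ^*) = v_K(𝔡_{K'/K}) ψ(1) +
f_{K'/K} f(ψ)`). [cite: SerreLocalFields1979, Ch. VI §2, Prop. 4 and its Corollary] -/
theorem artinSum_indClassFun (ι : Γ → ℕ) (hconj : ∀ s t : Γ, ι (t⁻¹ * s * t) = ι s)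
    (H : Subgroup Γ) [DecidablePred (· ∈ H)] (θ : H → ℂ) :
    artinSum ι (Literature.RepresentationTheory.FiniteGroups.indClassFun H θ) =
      (Nat.card H : ℂ)⁻¹ * Fintype.card Γ *
        (θ 1 * ∑ s ∈ univ.filter (· ∉ H), (ι s : ℂ) + artinSum (fun h : H => ι h) θ) := by
  classical
  set e : Γ → ℂ := Function.extend (Subtype.val : H → Γ) θ 0 with he
  set c : ℂ := (Nat.card H : ℂ)⁻¹ with hc
  have hind : ∀ s, Literature.RepresentationTheory.FiniteGroups.indClassFun H θ s = c * ∑ t, e (t⁻¹ * s * t) := fun s => rfl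
  -- the inner sum `Σ_u ι(u) e(u) = Σ_{h ∈ H} ι(h) θ(h)`
  have hS0 : ∑ u, (ι u : ℂ) * e u = ∑ h : H, (ι h : ℂ) * θ h := by
    rw [← Finset.sum_filter_of_ne (p := (· ∈ H)) (s := univ) (f := fun u => (ι u : ℂ) * e u)
      (fun u _ hu => by
        by_contra hu'
        exact hu (by rw [he, Literature.RepresentationTheory.FiniteGroups.extend_subtypeVal_of_not_mem H θ hu', mul_zero]))]
    rw [Finset.sum_subtype (univ.filter (· ∈ H)) (p := (· ∈ H)) (fun s => by simp)]
    refine Finset.sum_congr rfl fun h _ => ?_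
    rw [he, Literature.RepresentationTheory.FiniteGroups.extend_subtypeVal_apply]
  -- `Σ_s ι(s) Ind θ (s) = c |Γ| Σ_{h} ι(h) θ(h)`
  have h1 : ∑ s, (ι s : ℂ) * Literature.RepresentationTheory.FiniteGroups.indClassFun H θ s =
      c * Fintype.card Γ * ∑ h : H, (ι h : ℂ) * θ h := by
    simp_rw [hind]
    have : ∀ s, (ι s : ℂ) * (c * ∑ t, e (t⁻¹ * s * t)) = c * ∑ t, (ι s : ℂ) * e (t⁻¹ * s * t) := by
      intro s; rw [Finset.mul_sum, Finset.mul_sum, Finset.mul_sum]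
      exact Finset.sum_congr rfl fun t _ => by ring
    simp_rw [this]
    rw [← Finset.mul_sum, Finset.sum_comm]
    have inner : ∀ t : Γ, ∑ s, (ι s : ℂ) * e (t⁻¹ * s * t) = ∑ u, (ι u : ℂ) * e u := by
      intro t
      refine (Fintype.sum_equiv (MulAut.conj t).toEquiv (fun u => (ι u : ℂ) * e u)
        (fun s => (ι s : ℂ) * e (t⁻¹ * s * t)) fun u => ?_).symm
      simp only [MulEquiv.toEquiv_eq_coe, EquivLike.coe_coe, MulAut.conj_apply]
      rw [show t⁻¹ * (t * u * t⁻¹) * t = u by group]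
      congr 2
      have := hconj u t⁻¹
      rw [inv_inv] at this
      exact this.symm
    simp_rw [inner, hS0]
    rw [Finset.sum_const, Finset.card_univ, nsmul_eq_mul]
    ring
  -- `Ind θ (1) = c |Γ| θ(1)`
  have h2 : Literature.RepresentationTheory.FiniteGroups.indClassFun H θ 1 = c * (Fintype.card Γ * θ 1) :=
    Literature.RepresentationTheory.FiniteGroups.indClassFun_one H θ
  -- `Σ_s ι(s) = Σ_{s ∉ H} ι(s) + Σ_{h} ι(h)`
  have h3 : ∑ s, (ι s : ℂ) = ∑ s ∈ univ.filter (· ∉ H), (ι s : ℂ) + ∑ h : H, (ι h : ℂ) := by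
    rw [← Finset.sum_filter_add_sum_filter_not univ (· ∉ H)]
    congr 1
    rw [Finset.sum_subtype (univ.filter fun s => ¬ s ∉ H) (p := (· ∈ H)) (fun s => by simp)]
  have h4 : artinSum (fun h : H => ι h) θ = θ 1 * ∑ h : H, (ι h : ℂ) - ∑ h : H, (ι h : ℂ) * θ h := by
    rw [artinSum_def, Finset.mul_sum, ← Finset.sum_sub_distrib]
    exact Finset.sum_congr rfl fun h _ => by ring
  rw [artinSum_def]
  simp_rw [mul_sub]
  rw [Finset.sum_sub_distrib, ← Finset.sum_mul, h1, h2, h3, h4]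
  ring

open scoped Classical in
/-- **Artin's theorem, combinatorial core (Serre's proof of Thm 1', VI §2, p. 103).**  Let `Γ` be a
finite group with a weight `ι : Γ → ℕ` counting, for `s ≠ 1`, the indices `i < N` with `s ∈ F_i`
(`F_i ≤ Γ` a filtration), invariant under conjugation.  Assume the two arithmetic inputs in
numerator form — (D) `|H| ∣ Σ_{s ∉ H} ι(s)` for every subgroup `H` (integrality of the different
exponent, IV §1 Cor. to Prop. 4) and (HA) `|H| ∣ Σ_{i<N, H ∩ F_i ⊄ ker θ} |H ∩ F_i|` for every
degree-one character `θ` of every subgroup `H` (Prop. 5 Cor., Hasse–Arf) — and Brauer's induction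
theorem.  Then for every finite-dimensional complex representation `ρ` of `Γ`,
**`|Γ|` divides `Σ_{i<N} |F_i| · codim V^{F_i}`** (i.e. `f(χ) = Σ (g_i/g_0) codim V^{G_i} ∈ ℕ`):
by Brauer `χ = Σ n_k Ind θ_k`, and `g_0 f(Ind θ_k) = (Γ : H_k)(θ_k(1) Σ_{s ∉ H_k} ι + h_k f_{H_k}(θ_k))`
is a multiple of `|Γ|` by (D) and (HA).
Ref: Serre, *Local Fields*, Ch. VI §2, proof of Thms 1 and 1' (p. 103), with Props. 2, 4, 5.
[cite: SerreLocalFields1979, Ch. VI §2, Thm 1' (proof)] -/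
theorem card_dvd_sum_card_mul_codimFixed_of_brauer (F : ℕ → Subgroup Γ) (N : ℕ) (ι : Γ → ℕ)
    [∀ i, DecidablePred (· ∈ F i)]
    (hι : ∀ s, s ≠ 1 → ι s = ((range N).filter fun i => s ∈ F i).card)
    (hconj : ∀ s t : Γ, ι (t⁻¹ * s * t) = ι s)
    (hD : ∀ (H : Subgroup Γ) [DecidablePred (· ∈ H)],
      Nat.card H ∣ ∑ s ∈ univ.filter (· ∉ H), ι s)
    (hHA : ∀ (H : Subgroup Γ) (θ : H →* ℂˣ),
      Nat.card H ∣ ∑ i ∈ range N, if (H ⊓ F i).subgroupOf H ≤ θ.ker then 0 else Nat.card ↥(H ⊓ F i))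
    (hBr : Literature.RepresentationTheory.FiniteGroups.brauer_induction)
    {V : Type} [AddCommGroup V] [Module ℂ V] [FiniteDimensional ℂ V] (ρ : Representation ℂ Γ V) :
    Fintype.card Γ ∣ ∑ i ∈ range N, Nat.card (F i) * Representation.codimFixed ρ (F i) := by
  classical
  set T : ℕ := ∑ i ∈ range N, Nat.card (F i) * Representation.codimFixed ρ (F i) with hT
  -- `(T : ℂ) = artinSum ι χ`
  have hTχ : artinSum ι ρ.character = (T : ℂ) :=
    artinSum_trace_eq_natCast_sum F N ι hι ρ fun i _ =>
      Nat.cast_ne_zero.mpr (Nat.card_pos (α := F i)).ne'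
  -- Brauer
  obtain ⟨κ, _, H, θ, n, hχ⟩ := hBr Γ ρ.character ⟨V, _, _, inferInstance, ρ, rfl⟩
  -- the integers `d_k`, `a_k`
  choose d hd using fun k => hD (H k)
  choose a ha using fun k => hHA (H k) (θ k)
  -- each induced term is `|Γ| (d_k + a_k)`
  have hk : ∀ k, artinSum ι (Literature.RepresentationTheory.FiniteGroups.indClassFun (H k) fun h => (θ k h : ℂ)) =
      (Fintype.card Γ : ℂ) * (d k + a k : ℕ) := by
    intro k
    rw [artinSum_indClassFun ι hconj (H k) (fun h => (θ k h : ℂ)), map_one, Units.val_one, one_mul,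
      artinSum_degreeOne_eq_natCast_sum F N ι hι (H k) (θ k)]
    have hD' : (∑ s ∈ univ.filter (· ∉ H k), (ι s : ℂ)) = ((Nat.card (H k) * d k : ℕ) : ℂ) := by
      rw [← hd k, Nat.cast_sum]
    rw [hD', ha k]
    have hH0 : (Nat.card (H k) : ℂ) ≠ 0 := Nat.cast_ne_zero.mpr (Nat.card_pos (α := H k)).ne'
    push_cast
    field_simp
  have hsum : artinSum ι ρ.character = (Fintype.card Γ : ℂ) * ((∑ k, n k * (d k + a k : ℕ) : ℤ) : ℂ) := by
    rw [hχ, artinSum_finset_sum]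
    simp_rw [artinSum_smul, hk]
    push_cast
    rw [Finset.mul_sum]
    exact Finset.sum_congr rfl fun k _ => by ring
  rw [hTχ] at hsum
  have hZ : (T : ℤ) = (Fintype.card Γ : ℤ) * ∑ k, n k * (d k + a k : ℕ) := by
    exact_mod_cast hsum
  exact Int.natCast_dvd_natCast.mp ⟨_, hZ⟩

end EngineComplex

end Literature.NumberTheory.GaloisRepresentations

/-! ## Descent of a representation to a finitely generated coefficient ring (Lefschetz step) -/

namespace Literature.NumberTheory.GaloisRepresentations

open Finset Module Polynomial

section ProjCharpoly

variable {k V : Type*} [Field k] [AddCommGroup V] [Module k V] [FiniteDimensional k V]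

/-- The characteristic polynomial of a projection onto `p` is `(X - 1)^{dim p} · X^{dim ker}`
(Mathlib `LinearMap.IsProj.eq_conj_prodMap`: a projection is conjugate to `id × 0`). [folklore] -/
theorem charpoly_eq_of_isProj {p : Submodule k V} {f : V →ₗ[k] V} (h : LinearMap.IsProj p f) :
    f.charpoly = (X - 1) ^ finrank k p * X ^ finrank k (LinearMap.ker f) := by
  nth_rw 1 [h.eq_conj_prodMap]
  rw [LinearEquiv.charpoly_conj, LinearMap.charpoly_prodMap,
    ← Module.End.one_eq_id, LinearMap.charpoly_one, LinearMap.charpoly_zero]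

/-- The multiplicity of the root `1` in `(X - 1)^d · X^e` is `d`. [folklore] -/
theorem rootMultiplicity_one_X_sub_one_pow_mul_X_pow {R : Type*} [CommRing R] [IsDomain R]
    (d e : ℕ) : ((X - 1 : R[X]) ^ d * X ^ e).rootMultiplicity 1 = d := by
  have hX1 : (X - 1 : R[X]) = X - C 1 := by rw [map_one]
  have hne : ((X - 1 : R[X]) ^ d * X ^ e) ≠ 0 :=
    mul_ne_zero (pow_ne_zero _ (by rw [hX1]; exact X_sub_C_ne_zero 1)) (pow_ne_zero _ X_ne_zero)
  rw [rootMultiplicity_mul hne, hX1, rootMultiplicity_X_sub_C_pow, rootMultiplicity_eq_zero, add_zero]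
  simp [IsRoot]

/-- **The dimension of the fixed space is read off from the characteristic polynomial of the
averaging operator**: for a subgroup `P` with `|P| ≠ 0` in `k`, `dim V^P` is the multiplicity of
the root `1` of the characteristic polynomial of `|P|⁻¹ Σ_{s ∈ P} τ(s)` (a projection onto `V^P`,
Mathlib `Representation.isProj_averageMap`).  This is the quantity that is invariant under an
arbitrary change of coefficients (unlike the trace, which only determines `dim V^P` modulo the
characteristic). [folklore] -/
theorem finrank_fixedSubmodule_eq_rootMultiplicity {Γ : Type*} [Group Γ] [Fintype Γ]
    (τ : Representation k Γ V) (P : Subgroup Γ) [DecidablePred (· ∈ P)]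
    [Invertible (Fintype.card P : k)] :
    finrank k (Representation.fixedSubmodule τ P) =
      (Representation.averageMap (τ.comp P.subtype)).charpoly.rootMultiplicity 1 := by
  rw [charpoly_eq_of_isProj (Representation.isProj_averageMap (τ.comp P.subtype)),
    rootMultiplicity_one_X_sub_one_pow_mul_X_pow]
  rfl

omit [FiniteDimensional k V] in
/-- The averaging operator as an explicit linear combination: `|P|⁻¹ Σ_{s : P} τ(s)`.
[folklore] -/
theorem averageMap_comp_subtype_eq {Γ : Type*} [Group Γ] [Fintype Γ]
    (τ : Representation k Γ V) (P : Subgroup Γ) [DecidablePred (· ∈ P)]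
    [Invertible (Fintype.card P : k)] :
    Representation.averageMap (τ.comp P.subtype) =
      ⅟(Fintype.card P : k) • ∑ s ∈ univ.filter (· ∈ P), τ s := by
  simp only [Representation.averageMap, GroupAlgebra.average, map_smul, map_sum,
    Representation.asAlgebraHom_of, MonoidHom.coe_comp, Function.comp_apply, Subgroup.coe_subtype]
  congr 1
  exact (Finset.sum_subtype (univ.filter (· ∈ P)) (fun s => by simp) (fun s => τ s)).symm

end ProjCharpoly

section Model

variable {F₀ : Type*} [Field F₀] {A : Type*} [Field A] [Algebra F₀ A]
  {Γ : Type*} [Group Γ] [Fintype Γ]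
  {M : Type*} [AddCommGroup M] [Module A M] [FiniteDimensional A M]

/-- **Descent to a finitely generated coefficient ring and change of coefficients.**  A
representation `τ` of a finite group `Γ` on a finite-dimensional `A`-vector space `M` (over any
field `A`, an algebra over a field `F₀`, e.g. its prime field) is, in a basis, given by matrices
with entries in a finitely generated `F₀`-subalgebra `A₀ ⊆ A` (generated by the finitely many
matrix entries and the inverses of the orders of the subgroups `P` with `|P| ≠ 0` in `A`), i.e. by
a homomorphism `τ₀ : Γ → M_n(A₀)`; and for every ring homomorphism `g : A₀ → k` to a field, the
representation `s ↦ g(τ₀(s))` of `Γ` on `kⁿ` has, for every such `P`, a fixed space of the same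
dimension as `M^P`: the averaging idempotent `|P|⁻¹ Σ_{s ∈ P} τ₀(s) ∈ M_n(A₀)` has characteristic
polynomial `(X-1)^{dim M^P} X^{n - dim M^P}` (computed in `A`, where it is the projection onto
`M^P`; `A₀ → A` is injective), hence so does its image under `g`, which is the projection onto
`(kⁿ)^P`.  This is the standard "Lefschetz principle" reduction of statements about `codim V^{G_i}`
to a convenient coefficient field (Serre, VI §2: `ℂ`; Katz 1.9: `𝔽_λ`); used with `F₀ = ℚ`,
`k = ℂ` (via Zariski's lemma) and `F₀ = 𝔽_ℓ`, `k` finite. [folklore] -/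
theorem exists_matrix_model (τ : Representation A Γ M) :
    ∃ (A₀ : Subalgebra F₀ A) (_ : Algebra.FiniteType F₀ A₀)
      (τ₀ : Γ →* Matrix (Fin (finrank A M)) (Fin (finrank A M)) A₀),
      ∀ {k : Type*} [Field k] (g : A₀ →+* k) (P : Subgroup Γ), (Nat.card P : A) ≠ 0 →
        (Nat.card P : k) ≠ 0 ∧
        finrank k (Representation.fixedSubmodule
          ((Matrix.toLinAlgEquiv' (R := k) (n := Fin (finrank A M))).toRingEquiv.toMonoidHom.comp
            ((g.mapMatrix).toMonoidHom.comp τ₀)) P) =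
          finrank A (Representation.fixedSubmodule τ P) := by
  classical
  set n := finrank A M with hn
  let b : Basis (Fin n) A M := Module.finBasis A M
  -- the matrices of `τ`
  let mat : Γ →* Matrix (Fin n) (Fin n) A :=
    (LinearMap.toMatrixAlgEquiv b).toRingEquiv.toMonoidHom.comp τ
  have hmat : ∀ s, mat s = LinearMap.toMatrix b b (τ s) := fun s => rfl
  -- generators: entries and inverses of subgroup orders
  let gens : Set A :=
    Set.range (fun q : Γ × Fin n × Fin n => mat q.1 q.2.1 q.2.2) ∪
      Set.range (fun P : Subgroup Γ => ((Nat.card P : A))⁻¹)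
  have hgens : gens.Finite := (Set.finite_range _).union (Set.finite_range _)
  let A₀ : Subalgebra F₀ A := Algebra.adjoin F₀ gens
  have hA₀ : Algebra.FiniteType F₀ A₀ :=
    (Subalgebra.fg_iff_finiteType A₀).mp ⟨hgens.toFinset, by rw [Set.Finite.coe_toFinset]⟩
  have hmem : ∀ s i j, mat s i j ∈ A₀ := fun s i j =>
    Algebra.subset_adjoin (Set.mem_union_left _ ⟨(s, i, j), rfl⟩)
  have hinv : ∀ P : Subgroup Γ, ((Nat.card P : A))⁻¹ ∈ A₀ := fun P =>
    Algebra.subset_adjoin (Set.mem_union_right _ ⟨P, rfl⟩)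
  -- injectivity of `M_n(A₀) → M_n(A)`
  have hinj : Function.Injective
      (fun X : Matrix (Fin n) (Fin n) A₀ => X.map (algebraMap A₀ A)) :=
    Matrix.map_injective Subtype.val_injective
  -- the model `τ₀`
  let t₀ : Γ → Matrix (Fin n) (Fin n) A₀ := fun s => Matrix.of fun i j => ⟨mat s i j, hmem s i j⟩
  have ht₀ : ∀ s, (t₀ s).map (algebraMap A₀ A) = mat s := fun s => rfl
  have ht₀' : ∀ s, (algebraMap A₀ A).mapMatrix (t₀ s) = mat s := fun s => rfl
  let τ₀ : Γ →* Matrix (Fin n) (Fin n) A₀ :=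
    { toFun := t₀
      map_one' := hinj (by
        change (t₀ 1).map _ = (1 : Matrix (Fin n) (Fin n) A₀).map _
        rw [ht₀, map_one, ← RingHom.mapMatrix_apply, map_one])
      map_mul' := fun s t => hinj (by
        change (t₀ (s * t)).map _ = (t₀ s * t₀ t).map _
        rw [ht₀, map_mul, ← RingHom.mapMatrix_apply, map_mul, RingHom.mapMatrix_apply,
          RingHom.mapMatrix_apply, ht₀, ht₀]) }
  have hτ₀ : ∀ s, (τ₀ s).map (algebraMap A₀ A) = mat s := fun s => rfl
  refine ⟨A₀, hA₀, τ₀, fun {k} _ g P hP => ?_⟩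
  -- the inverse of `|P|` in `A₀` and in `k`
  have hcardA : (Fintype.card P : A) = Nat.card P := by rw [Nat.card_eq_fintype_card]
  have hcardk : (Fintype.card P : k) = Nat.card P := by rw [Nat.card_eq_fintype_card]
  set u : A₀ := ⟨((Nat.card P : A))⁻¹, hinv P⟩ with hu
  have huA : (u : A) * (Nat.card P : A) = 1 := inv_mul_cancel₀ hP
  have huA₀ : u * (Nat.card P : A₀) = 1 := Subtype.ext (by simpa using huA)
  have huk : g u * (Nat.card P : k) = 1 := by
    have := congrArg g huA₀
    rwa [map_mul, map_natCast, map_one] at this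
  have hPk : (Nat.card P : k) ≠ 0 := by
    intro h0
    rw [h0, mul_zero] at huk
    exact zero_ne_one huk
  refine ⟨hPk, ?_⟩
  letI iA : Invertible (Fintype.card P : A) := invertibleOfNonzero (by rwa [hcardA])
  letI ik : Invertible (Fintype.card P : k) := invertibleOfNonzero (by rwa [hcardk])
  have hinvA : ⅟(Fintype.card P : A) = (u : A) := by
    rw [invOf_eq_inv, hcardA]
  have hinvk : ⅟(Fintype.card P : k) = g u := by
    rw [invOf_eq_inv, hcardk]
    exact (eq_inv_of_mul_eq_one_left huk).symm
  -- the averaging idempotent `E ∈ M_n(A₀)`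
  set E : Matrix (Fin n) (Fin n) A₀ := u • ∑ s ∈ univ.filter (· ∈ P), τ₀ s with hE
  -- over `A`: the matrix of the averaging operator is `E.map val`
  have hEA : LinearMap.toMatrix b b (Representation.averageMap (τ.comp P.subtype)) =
      E.map (algebraMap A₀ A) := by
    rw [averageMap_comp_subtype_eq, hinvA, LinearEquiv.map_smul, map_sum]
    ext i j
    simp only [hE, Matrix.map_apply, Matrix.smul_apply, Matrix.sum_apply, smul_eq_mul, map_mul,
      map_sum]
    rfl
  -- over `k`
  set τk : Representation k Γ (Fin n → k) :=
    (Matrix.toLinAlgEquiv' (R := k) (n := Fin n)).toRingEquiv.toMonoidHom.comp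
      ((g.mapMatrix).toMonoidHom.comp τ₀) with hτk
  have hτk_apply : ∀ s, τk s = Matrix.toLin' ((τ₀ s).map g) := fun s => rfl
  have hEk : LinearMap.toMatrix' (Representation.averageMap (τk.comp P.subtype)) = E.map g := by
    rw [averageMap_comp_subtype_eq, hinvk, LinearEquiv.map_smul, map_sum]
    simp_rw [hτk_apply, LinearMap.toMatrix'_toLin']
    ext i j
    simp only [hE, Matrix.map_apply, Matrix.smul_apply, Matrix.sum_apply, smul_eq_mul, map_mul,
      map_sum]
  -- characteristic polynomials
  set d := finrank A (Representation.fixedSubmodule τ P) with hd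
  set e := finrank A (LinearMap.ker (Representation.averageMap (τ.comp P.subtype))) with he
  have hchA : (E.map (algebraMap A₀ A)).charpoly = (X - 1) ^ d * X ^ e := by
    rw [← hEA, LinearMap.charpoly_toMatrix,
      charpoly_eq_of_isProj (Representation.isProj_averageMap (τ.comp P.subtype))]
    rfl
  have hchA₀ : E.charpoly = (X - 1) ^ d * X ^ e := by
    apply Polynomial.map_injective (algebraMap A₀ A) Subtype.val_injective
    rw [← Matrix.charpoly_map, hchA]
    simp [Polynomial.map_pow, Polynomial.map_mul, Polynomial.map_sub]
  have hchk : (Representation.averageMap (τk.comp P.subtype)).charpoly = (X - 1) ^ d * X ^ e := by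
    rw [← LinearMap.charpoly_toMatrix _ (Pi.basisFun k (Fin n)), LinearMap.toMatrix_eq_toMatrix',
      hEk, Matrix.charpoly_map, hchA₀]
    simp [Polynomial.map_pow, Polynomial.map_mul, Polynomial.map_sub]
  rw [finrank_fixedSubmodule_eq_rootMultiplicity τk P, hchk,
    rootMultiplicity_one_X_sub_one_pow_mul_X_pow]

end Model

section CoefficientChange

universe v

/-- **Zariski's lemma, characteristic `0`**: a finitely generated `ℚ`-subalgebra of a field maps
to `ℂ` (the residue field at a maximal ideal is a finite extension of `ℚ`, Mathlib
`finite_of_finite_type_of_isJacobsonRing`, and embeds into the algebraically closed field `ℂ`,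
`IsAlgClosed.lift`). [folklore] -/
theorem nonempty_ringHom_complex {A : Type v} [Field A] [Algebra ℚ A] (A₀ : Subalgebra ℚ A)
    [Algebra.FiniteType ℚ A₀] : Nonempty (A₀ →+* ℂ) := by
  obtain ⟨m, hm⟩ := Ideal.exists_maximal A₀
  letI : Field (A₀ ⧸ m) := Ideal.Quotient.field m
  haveI : Algebra.FiniteType ℚ (A₀ ⧸ m) :=
    Algebra.FiniteType.of_surjective (Ideal.Quotient.mkₐ ℚ m) (Ideal.Quotient.mkₐ_surjective _ _)
  haveI : Module.Finite ℚ (A₀ ⧸ m) := finite_of_finite_type_of_isJacobsonRing ℚ (A₀ ⧸ m)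
  haveI : Algebra.IsAlgebraic ℚ (A₀ ⧸ m) := Algebra.IsAlgebraic.of_finite ℚ (A₀ ⧸ m)
  haveI : Module.IsTorsionFree ℚ (A₀ ⧸ m) :=
    Module.isTorsionFree_iff_algebraMap_injective.mpr (algebraMap ℚ (A₀ ⧸ m)).injective
  haveI : Module.IsTorsionFree ℚ ℂ :=
    Module.isTorsionFree_iff_algebraMap_injective.mpr (algebraMap ℚ ℂ).injective
  let emb : (A₀ ⧸ m) →ₐ[ℚ] ℂ := IsAlgClosed.lift
  exact ⟨emb.toRingHom.comp (Ideal.Quotient.mk m)⟩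

/-- **Zariski's lemma, characteristic `ℓ`**: a finitely generated `𝔽_ℓ`-subalgebra of a field maps
to a finite field of characteristic `ℓ` (its residue field at a maximal ideal, finite over `𝔽_ℓ` by
Mathlib `finite_of_finite_type_of_isJacobsonRing`). [folklore] -/
theorem exists_ringHom_finite {ℓ : ℕ} [Fact ℓ.Prime] {A : Type v} [Field A] [Algebra (ZMod ℓ) A]
    (A₀ : Subalgebra (ZMod ℓ) A) [Algebra.FiniteType (ZMod ℓ) A₀] :
    ∃ (κ : Type v) (_ : Field κ) (_ : Finite κ) (_ : CharP κ ℓ), Nonempty (A₀ →+* κ) := by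
  obtain ⟨m, hm⟩ := Ideal.exists_maximal A₀
  letI : Field (A₀ ⧸ m) := Ideal.Quotient.field m
  haveI : Algebra.FiniteType (ZMod ℓ) (A₀ ⧸ m) :=
    Algebra.FiniteType.of_surjective (Ideal.Quotient.mkₐ (ZMod ℓ) m)
      (Ideal.Quotient.mkₐ_surjective _ _)
  haveI : Module.Finite (ZMod ℓ) (A₀ ⧸ m) :=
    finite_of_finite_type_of_isJacobsonRing (ZMod ℓ) (A₀ ⧸ m)
  haveI : Finite (A₀ ⧸ m) := Module.finite_of_finite (ZMod ℓ)
  haveI : CharP (A₀ ⧸ m) ℓ :=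
    charP_of_injective_algebraMap (algebraMap (ZMod ℓ) (A₀ ⧸ m)).injective ℓ
  exact ⟨A₀ ⧸ m, inferInstance, inferInstance, inferInstance, ⟨Ideal.Quotient.mk m⟩⟩

end CoefficientChange

end Literature.NumberTheory.GaloisRepresentations

/-! ## The number-field instantiation: Artin's theorem for the inertia group -/

namespace Literature.NumberTheory.GaloisRepresentations

open Finset Module IsDedekindDomain

section Transport

variable {Γ Γ' : Type*} [Group Γ] [Group Γ'] {A : Type*} [CommRing A] {M : Type*} [AddCommGroup M]
  [Module A M]

/-- Fixed spaces are unchanged by transporting a representation along a group isomorphism.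
[folklore] -/
theorem fixedSubmodule_comp_mulEquiv (τ : Representation A Γ M) (e : Γ' ≃* Γ) (P : Subgroup Γ) :
    Representation.fixedSubmodule (τ.comp e.toMonoidHom) (P.comap e.toMonoidHom) =
      Representation.fixedSubmodule τ P := by
  ext v
  simp only [Representation.mem_fixedSubmodule, Subgroup.mem_comap, MonoidHom.coe_comp,
    Function.comp_apply, MulEquiv.coe_toMonoidHom]
  constructor
  · intro h g hg
    have := h (e.symm g) (by simpa using hg)
    simpa using this
  · intro h g hg
    exact h _ hg

/-- Codimensions of fixed spaces are unchanged by transport along a group isomorphism.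
[folklore] -/
theorem codimFixed_comp_mulEquiv (τ : Representation A Γ M) (e : Γ' ≃* Γ) (P : Subgroup Γ) :
    Representation.codimFixed (τ.comp e.toMonoidHom) (P.comap e.toMonoidHom) =
      Representation.codimFixed τ P := by
  unfold Representation.codimFixed
  rw [fixedSubmodule_comp_mulEquiv]

/-- The trivial subgroup fixes everything: `codim M^{1} = 0`. [folklore] -/
theorem codimFixed_bot [Nontrivial A] (τ : Representation A Γ M) :
    Representation.codimFixed τ ⊥ = 0 := by
  unfold Representation.codimFixed
  have htop : Representation.fixedSubmodule τ (⊥ : Subgroup Γ) = ⊤ := by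
    rw [eq_top_iff]
    intro x _
    rw [Representation.mem_fixedSubmodule]
    intro h hh
    rw [Subgroup.mem_bot] at hh
    subst hh
    rw [map_one, Module.End.one_apply]
  rw [htop]
  haveI : Subsingleton (M ⧸ (⊤ : Submodule A M)) := Submodule.Quotient.subsingleton_iff.mpr rfl
  exact finrank_zero_of_subsingleton

end Transport

section FiniteSum

variable {S : Type*} [CommRing S] (𝔓 : Ideal S) (G : Type*) [Group G] [MulSemiringAction G S]
  {H : Type*} [Group H] {A : Type*} [Field A] {M : Type*} [AddCommGroup M] [Module A M]

/-- **`f(τ)` as a finite sum**: if `G_i = 1` for `i ≥ N` and `j` is injective, then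
`f(τ) = (Σ_{i<N} g_i · codim M^{j⁻¹ G_i}) / g_0` (the terms `i ≥ N` of the lower-numbering
formula vanish).  Ref: Serre, *Local Fields*, Ch. VI §2, Cor. 1' to Prop. 2; Ch. IV §1 Prop. 1
(`G_i = 1` for `i ≫ 0`). [cite: SerreLocalFields1979, Ch. VI §2, Cor. 1' to Prop. 2] -/
theorem artinExponent_eq_sum_div (j : H →* G) (hj : Function.Injective j)
    (τ : Representation A H M) {N : ℕ} (hN : ∀ i, N ≤ i → 𝔓.ramificationSubgroup G i = ⊥) :
    artinExponent 𝔓 G j τ =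
      ((∑ i ∈ Finset.range N, Nat.card (𝔓.ramificationSubgroup G i) *
          Representation.codimFixed τ ((𝔓.ramificationSubgroup G i).comap j) : ℕ) : ℝ) /
        Nat.card (𝔓.inertia G) := by
  have hzero : ∀ i, N ≤ i →
      Representation.codimFixed τ ((𝔓.ramificationSubgroup G i).comap j) = 0 := by
    intro i hi
    rw [hN i hi, MonoidHom.comap_bot, (MonoidHom.ker_eq_bot_iff j).mpr hj]
    exact codimFixed_bot τ
  rw [artinExponent_def, finsum_eq_sum_of_support_subset _ (s := Finset.range N)]
  · rw [Nat.cast_sum, Finset.sum_div]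
    refine Finset.sum_congr rfl fun i _ => ?_
    rw [𝔓.ramificationSubgroup_zero G, Nat.cast_mul]
    ring
  · intro i hi
    rw [Function.mem_support] at hi
    by_contra h
    rw [Finset.coe_range, Set.mem_Iio, not_lt] at h
    exact hi (by rw [hzero i h, Nat.cast_zero, mul_zero])

/-- The cardinality of `j⁻¹ G_i` for `j` injective with range containing `G_0`. [folklore] -/
theorem card_comap_ramificationSubgroup (j : H →* G) (hj : Function.Injective j)
    (hI : 𝔓.inertia G ≤ j.range) (i : ℕ) :
    Nat.card ((𝔓.ramificationSubgroup G i).comap j) = Nat.card (𝔓.ramificationSubgroup G i) := by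
  have hle : 𝔓.ramificationSubgroup G i ≤ j.range := (𝔓.ramificationSubgroup_le_inertia G i).trans hI
  refine Nat.card_congr ?_
  refine Equiv.ofBijective (fun x => ⟨j x.1, x.2⟩) ⟨fun x y h => Subtype.ext (hj ?_), fun y => ?_⟩
  · exact congrArg Subtype.val h
  · obtain ⟨x, hx⟩ := hle y.2
    exact ⟨⟨x, show j x ∈ _ by rw [hx]; exact y.2⟩, Subtype.ext hx⟩

end FiniteSum

section Pullback

variable {S : Type*} [CommRing S] (𝔓 : Ideal S) {G : Type*} [Group G] [MulSemiringAction G S]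
  [Fintype G] {Γ : Type*} [Group Γ] [Fintype Γ]

omit [Fintype G] in
open scoped Classical in
/-- **`i_G(s)` as a count**: if `G_i = 1` for `i ≥ N` and `s ≠ 1`, then `i_G(s)` (`Literature.NumberTheory.GaloisRepresentations.lowerIndex`,
finite here) is the number of indices `i < N` with `s ∈ G_i` — the set of such `i` is the initial
segment `[0, i_G(s))` since the `G_i` decrease.
Ref: Serre, *Local Fields*, Ch. IV §1, after Prop. 1 (`i_G(s) ≥ i + 1 ⇔ s ∈ G_i`; "if `s ≠ 1`,
`i_G(s)` is a non-negative integer"). [cite: SerreLocalFields1979, Ch. IV §1 Prop. 1] -/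
theorem lowerIndex_toNat_eq_card_filter {N : ℕ}
    (hN : ∀ i, N ≤ i → 𝔓.ramificationSubgroup G i = ⊥) {s : G} (hs : s ≠ 1) :
    (lowerIndex 𝔓 G s).toNat =
      ((Finset.range N).filter fun i => s ∈ 𝔓.ramificationSubgroup G i).card := by
  have hsN : s ∉ 𝔓.ramificationSubgroup G N := by
    rw [hN N le_rfl, Subgroup.mem_bot]
    exact hs
  have hex : ∃ i, s ∉ 𝔓.ramificationSubgroup G i := ⟨N, hsN⟩
  set n := Nat.find hex with hn
  have hnot : s ∉ 𝔓.ramificationSubgroup G n := Nat.find_spec hex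
  have hmem : ∀ i, i < n → s ∈ 𝔓.ramificationSubgroup G i := fun i hi =>
    not_not.mp (Nat.find_min hex hi)
  have hiff : ∀ i, s ∈ 𝔓.ramificationSubgroup G i ↔ i < n := fun i =>
    ⟨fun h => by
      by_contra hi
      exact hnot (𝔓.ramificationSubgroup_antitone G (not_lt.mp hi) h), hmem i⟩
  have hnN : n ≤ N := Nat.find_le hsN
  have hidx : lowerIndex 𝔓 G s = n := by
    refine le_antisymm ((lowerIndex_le_natCast_iff 𝔓).mpr hnot) ?_
    rcases Nat.eq_zero_or_pos n with h0 | hpos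
    · rw [h0, Nat.cast_zero]
      exact zero_le
    · have h1 := add_one_le_lowerIndex 𝔓 (hmem (n - 1) (Nat.sub_lt hpos one_pos))
      have h' : (((n - 1 : ℕ) : ℕ∞) + 1) = (n : ℕ∞) := by
        have : ((n - 1 + 1 : ℕ) : ℕ∞) = (n : ℕ∞) := by rw [Nat.sub_add_cancel hpos]
        rw [← this]
        push_cast [Nat.cast_sub hpos]
        ring
      rwa [h'] at h1
  rw [hidx, ENat.toNat_coe]
  have hfilter : ((Finset.range N).filter fun i => s ∈ 𝔓.ramificationSubgroup G i) =
      Finset.range n := by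
    ext i
    simp only [Finset.mem_filter, Finset.mem_range, hiff]
    omega
  rw [hfilter, Finset.card_range]

omit [Fintype G] in
/-- **Pull-back of the different-exponent integrality along `j : Γ ≅ G_0`**: from
`|H ∩ G_0| ∣ Σ_{s ∉ H} i_G(s)` for the subgroup `H = j(H')` of `G` to
`|H'| ∣ Σ_{s ∉ H'} i_G(j s)` (`i_G = Literature.lowerIndex` vanishes off `G_0 = j(Γ)`).
Ref: Serre, *Local Fields*, Ch. IV §1, Cor. to Prop. 4. [cite: SerreLocalFields1979, Ch. IV §1, Cor. to Prop. 4] -/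
theorem card_dvd_sum_lowerIndex_of [Fintype G] (j : Γ →* G) (hj : Function.Injective j)
    (hjr : j.range = 𝔓.inertia G) (H' : Subgroup Γ) [DecidablePred (· ∈ H')]
    (h : Nat.card ↥(H'.map j ⊓ 𝔓.inertia G) ∣
      ∑ᶠ (s : G) (_ : s ∉ H'.map j), (lowerIndex 𝔓 G s).toNat) :
    Nat.card H' ∣ ∑ s ∈ univ.filter (· ∉ H'), (lowerIndex 𝔓 G (j s)).toNat := by
  classical
  have hHle : H'.map j ≤ 𝔓.inertia G := by
    rw [← hjr]; exact Subgroup.map_le_range j H'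
  rw [inf_eq_left.mpr hHle, Nat.card_congr (H'.equivMapOfInjective j hj).toEquiv.symm] at h
  rw [finsum_cond_eq_sum_of_cond_iff (t := univ.filter (· ∉ H'.map j)) _ (fun _ => by simp)] at h
  convert h using 1
  -- reindex: the summand vanishes off `j(Γ) = G_0`
  symm
  calc ∑ s ∈ univ.filter (· ∉ H'.map j), (lowerIndex 𝔓 G s).toNat
      = ∑ s ∈ (univ.filter (· ∉ H')).image j, (lowerIndex 𝔓 G s).toNat := by
        refine (Finset.sum_subset ?_ ?_).symm
        · intro s hs
          simp only [Finset.mem_image, Finset.mem_filter, Finset.mem_univ, true_and] at hs ⊢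
          obtain ⟨x, hx, rfl⟩ := hs
          rwa [Subgroup.mem_map_iff_mem hj]
        · intro s hs hs'
          have hsI : s ∉ 𝔓.inertia G := by
            intro hsI
            rw [← hjr] at hsI
            obtain ⟨x, rfl⟩ := hsI
            simp only [Finset.mem_image, Finset.mem_filter, Finset.mem_univ, true_and, not_exists,
              not_and] at hs hs'
            rw [Subgroup.mem_map_iff_mem hj] at hs
            exact hs' x hs rfl
          rw [(lowerIndex_eq_zero_iff 𝔓).mpr (by rwa [𝔓.ramificationSubgroup_zero]), ENat.toNat_zero]
    _ = ∑ s ∈ univ.filter (· ∉ H'), (lowerIndex 𝔓 G (j s)).toNat :=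
        Finset.sum_image fun _ _ _ _ hxy => hj hxy

omit [Fintype G] [Fintype Γ] in
open scoped Classical in
/-- **Pull-back of the degree-one integrality along `j : Γ ≅ G_0`**: from the statement for the
subgroup `H = j(H')` of `G` and the character `θ ∘ (j|_{H'})⁻¹` to the statement for `H'`, `θ` and
the induced filtration `j⁻¹ G_i`; only indices `i < N` contribute when `G_i = 1` for `i ≥ N`.
Ref: Serre, *Local Fields*, Ch. VI §2, Prop. 5 and Corollary. [cite: SerreLocalFields1979, Ch. VI §2, Prop. 5 and its Corollary] -/
theorem card_dvd_sum_card_of (j : Γ →* G) (hj : Function.Injective j)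
    (hjr : j.range = 𝔓.inertia G) {N : ℕ} (hN : ∀ i, N ≤ i → 𝔓.ramificationSubgroup G i = ⊥)
    (H' : Subgroup Γ) (θ : H' →* ℂˣ)
    (h : Nat.card ↥(H'.map j ⊓ 𝔓.inertia G) ∣
      ∑ᶠ i : ℕ, if (H'.map j ⊓ 𝔓.ramificationSubgroup G i).subgroupOf (H'.map j) ≤
          (θ.comp (H'.equivMapOfInjective j hj).symm.toMonoidHom).ker then 0
        else Nat.card ↥(H'.map j ⊓ 𝔓.ramificationSubgroup G i)) :
    Nat.card H' ∣ ∑ i ∈ range N,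
      if (H' ⊓ (𝔓.ramificationSubgroup G i).comap j).subgroupOf H' ≤ θ.ker then 0
      else Nat.card ↥(H' ⊓ (𝔓.ramificationSubgroup G i).comap j) := by
  set H := H'.map j with hH
  set eH : H' ≃* H := H'.equivMapOfInjective j hj with heH
  have hHle : H ≤ 𝔓.inertia G := by
    rw [hH, ← hjr]; exact Subgroup.map_le_range j H'
  rw [inf_eq_left.mpr hHle, Nat.card_congr eH.toEquiv.symm] at h
  -- termwise comparison
  have hmap : ∀ i, (H' ⊓ (𝔓.ramificationSubgroup G i).comap j).map j =
      H ⊓ 𝔓.ramificationSubgroup G i := by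
    intro i
    ext s
    simp only [Subgroup.mem_map, Subgroup.mem_inf, Subgroup.mem_comap, hH]
    constructor
    · rintro ⟨x, ⟨hx, hx'⟩, rfl⟩
      exact ⟨⟨x, hx, rfl⟩, hx'⟩
    · rintro ⟨⟨x, hx, rfl⟩, hs⟩
      exact ⟨x, ⟨hx, hs⟩, rfl⟩
  have hcard : ∀ i, Nat.card ↥(H ⊓ 𝔓.ramificationSubgroup G i) =
      Nat.card ↥(H' ⊓ (𝔓.ramificationSubgroup G i).comap j) := by
    intro i
    rw [← hmap i]
    exact (Nat.card_congr ((H' ⊓ _).equivMapOfInjective j hj).toEquiv).symm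
  have hker : ∀ i, ((H ⊓ 𝔓.ramificationSubgroup G i).subgroupOf H ≤
      (θ.comp eH.symm.toMonoidHom).ker) ↔
        ((H' ⊓ (𝔓.ramificationSubgroup G i).comap j).subgroupOf H' ≤ θ.ker) := by
    intro i
    constructor
    · intro hle x hx
      rw [Subgroup.mem_subgroupOf, Subgroup.mem_inf, Subgroup.mem_comap] at hx
      have hx' : (eH x : G) ∈ H ⊓ 𝔓.ramificationSubgroup G i := by
        rw [heH, Subgroup.coe_equivMapOfInjective_apply]
        exact ⟨⟨x, x.2, rfl⟩, hx.2⟩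
      have := hle (show eH x ∈ (H ⊓ 𝔓.ramificationSubgroup G i).subgroupOf H from hx')
      rw [MonoidHom.mem_ker, MonoidHom.coe_comp, Function.comp_apply, MulEquiv.coe_toMonoidHom,
        MulEquiv.symm_apply_apply] at this
      exact this
    · intro hle y hy
      rw [Subgroup.mem_subgroupOf, Subgroup.mem_inf] at hy
      rw [MonoidHom.mem_ker, MonoidHom.coe_comp, Function.comp_apply, MulEquiv.coe_toMonoidHom]
      apply hle
      rw [Subgroup.mem_subgroupOf, Subgroup.mem_inf, Subgroup.mem_comap]
      have hy1 : ((eH.symm y : H') : Γ) ∈ H' := (eH.symm y).2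
      have hjy : j (eH.symm y : Γ) = (y : G) := by
        have := Subgroup.coe_equivMapOfInjective_apply H' j hj (eH.symm y)
        rw [← heH, MulEquiv.apply_symm_apply] at this
        exact this.symm
      exact ⟨hy1, by rw [hjy]; exact hy.2⟩
  rw [finsum_eq_sum_of_support_subset _ (s := range N)] at h
  · convert h using 1
    refine Finset.sum_congr rfl fun i _ => ?_
    rw [hcard i]
    by_cases hle : (H' ⊓ (𝔓.ramificationSubgroup G i).comap j).subgroupOf H' ≤ θ.ker
    · rw [if_pos hle, if_pos ((hker i).mpr hle)]
    · rw [if_neg hle, if_neg (fun h' => hle ((hker i).mp h'))]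
  · intro i hi
    rw [Function.mem_support] at hi
    by_contra hiN
    rw [Finset.coe_range, Set.mem_Iio, not_lt] at hiN
    apply hi
    rw [if_pos]
    intro x hx
    rw [Subgroup.mem_subgroupOf, hN i hiN, inf_bot_eq, Subgroup.mem_bot] at hx
    rw [MonoidHom.mem_ker, OneMemClass.coe_eq_one.mp hx, map_one]

end Pullback


section Core

universe u v w

variable {K : Type u} [Field K]

open scoped Classical in
/-- **The characteristic-`0` heart: `g_0 ∣ Σ_i g_i codim V^{G_i}` for a complex representation of
the inertia group, from Brauer's theorem and the two arithmetic inputs.**  Setting: `R` Dedekind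
with fraction field `K`, `L/K` finite Galois with group `G`, `𝔔` a maximal ideal of
`integralClosure R L` with separable residue extension, `I = G_0 = I(𝔔)`, `G_i = 1` for `i ≥ N`.
The inertia group is transported to universe `0` (`Shrink`, so that `Literature.RepresentationTheory.FiniteGroups.brauer_induction`
and `indClassFun` apply), the weight is `ι = i_G ∘ j` for `j : Shrink G_0 ≅ G_0 ≤ G`, and the
inputs (D), (HA) of `card_dvd_sum_card_mul_codimFixed_of_brauer` are the named facts pulled back
along `j` (`card_dvd_sum_lowerIndex_of`, `card_dvd_sum_card_of`).
Ref: Serre, *Local Fields*, Ch. VI §2, proof of Thm 1' (p. 103).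
[cite: SerreLocalFields1979, Ch. VI §2, Thm 1' (proof)] -/
theorem card_inertia_dvd_sum_of_brauer (R : Type u) {L : Type*} [CommRing R]
    [IsDedekindDomain R] [Algebra R K] [IsFractionRing R K] [Field L] [Algebra K L]
    [Algebra R L] [IsScalarTower R K L] [FiniteDimensional K L] [IsGalois K L]
    (𝔔 : Ideal (integralClosure R L)) [𝔔.IsMaximal]
    [Algebra.IsSeparable (R ⧸ 𝔔.under R) (integralClosure R L ⧸ 𝔔)]
    (I : Subgroup (L ≃ₐ[K] L)) (hI : I = 𝔔.inertia (L ≃ₐ[K] L))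
    {N : ℕ} (hN : ∀ i, N ≤ i → 𝔔.ramificationSubgroup (L ≃ₐ[K] L) i = ⊥)
    (hBr : Literature.RepresentationTheory.FiniteGroups.brauer_induction)
    (hD : card_inf_inertia_dvd_finsum_lowerIndex R (K := K) (L := L))
    (hHA : card_inf_inertia_dvd_finsum_card_inf_ramificationSubgroup R (K := K) (L := L))
    {V : Type} [AddCommGroup V] [Module ℂ V] [FiniteDimensional ℂ V] (τC : Representation ℂ I V) :
    Nat.card I ∣ ∑ i ∈ range N, Nat.card (𝔔.ramificationSubgroup (L ≃ₐ[K] L) i) *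
      Representation.codimFixed τC ((𝔔.ramificationSubgroup (L ≃ₐ[K] L) i).comap I.subtype) := by
  classical
  set e : Shrink.{0} I ≃* I := Shrink.mulEquiv with he
  letI : Fintype (Shrink.{0} I) := Fintype.ofEquiv I e.toEquiv.symm
  set j : Shrink.{0} I →* (L ≃ₐ[K] L) := I.subtype.comp e.toMonoidHom with hj
  have hjinj : Function.Injective j := Subtype.val_injective.comp e.injective
  have hjr : j.range = 𝔔.inertia (L ≃ₐ[K] L) := by
    rw [← hI]
    ext s
    constructor
    · rintro ⟨x, rfl⟩
      exact (e x).2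
    · intro hs
      exact ⟨e.symm ⟨s, hs⟩, by simp [hj]⟩
  have hIj : 𝔔.inertia (L ≃ₐ[K] L) ≤ j.range := by rw [hjr]
  set ρ : Representation ℂ (Shrink.{0} I) V := τC.comp e.toMonoidHom with hρ
  set F : ℕ → Subgroup (Shrink.{0} I) :=
    fun i => (𝔔.ramificationSubgroup (L ≃ₐ[K] L) i).comap j with hF
  set ι : Shrink.{0} I → ℕ := fun s => (lowerIndex 𝔔 (L ≃ₐ[K] L) (j s)).toNat with hι
  have hιN : ∀ s, s ≠ 1 → ι s = ((range N).filter fun i => s ∈ F i).card := by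
    intro s hs
    simp only [hι, hF]
    rw [lowerIndex_toNat_eq_card_filter 𝔔 hN (fun h1 => hs (hjinj (by rw [h1, map_one])))]
    rfl
  have hconj : ∀ s t : Shrink.{0} I, ι (t⁻¹ * s * t) = ι s := by
    intro s t
    simp only [hι, map_mul, map_inv]
    have ht : (j t)⁻¹ ∈ 𝔔.decompositionSubgroup (L ≃ₐ[K] L) :=
      Subgroup.inv_mem _ (𝔔.inertia_le_decompositionSubgroup (L ≃ₐ[K] L) (hjr ▸ ⟨t, rfl⟩))
    have := lowerIndex_conj 𝔔 (s := j s) ht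
    rw [inv_inv] at this
    rw [this]
  have hD' : ∀ (H : Subgroup (Shrink.{0} I)) [DecidablePred (· ∈ H)],
      Nat.card H ∣ ∑ s ∈ univ.filter (· ∉ H), ι s := by
    intro H _
    exact card_dvd_sum_lowerIndex_of 𝔔 j hjinj hjr H (hD 𝔔 (H.map j))
  have hHA' : ∀ (H : Subgroup (Shrink.{0} I)) (θ : H →* ℂˣ),
      Nat.card H ∣ ∑ i ∈ range N,
        if (H ⊓ F i).subgroupOf H ≤ θ.ker then 0 else Nat.card ↥(H ⊓ F i) := by
    intro H θ
    exact card_dvd_sum_card_of 𝔔 j hjinj hjr hN H θ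
      (hHA 𝔔 (H.map j) (θ.comp (H.equivMapOfInjective j hjinj).symm.toMonoidHom))
  have hmain := card_dvd_sum_card_mul_codimFixed_of_brauer F N ι hιN hconj hD' hHA' hBr ρ
  -- translate back
  have hcardΓ : Fintype.card (Shrink.{0} I) = Nat.card I := by
    rw [← Nat.card_eq_fintype_card]
    exact Nat.card_congr e.toEquiv
  have hterm : ∀ i, Nat.card (F i) * Representation.codimFixed ρ (F i) =
      Nat.card (𝔔.ramificationSubgroup (L ≃ₐ[K] L) i) *
        Representation.codimFixed τC ((𝔔.ramificationSubgroup (L ≃ₐ[K] L) i).comap I.subtype) := by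
    intro i
    rw [card_comap_ramificationSubgroup 𝔔 (L ≃ₐ[K] L) j hjinj hIj i]
    congr 1
    rw [show F i = ((𝔔.ramificationSubgroup (L ≃ₐ[K] L) i).comap I.subtype).comap
      e.toMonoidHom from (Subgroup.comap_comap _ _ _).symm, hρ, codimFixed_comp_mulEquiv]
  rw [hcardΓ, Finset.sum_congr rfl fun i _ => hterm i] at hmain
  exact hmain

/-- **Artin's theorem for the inertia group, from the named facts (generic Dedekind level).**
Let `R` be a Dedekind domain with fraction field `K` of characteristic `0`, `L/K` finite Galois
with group `G`, `𝔔` a maximal ideal of `S_L = integralClosure R L` with separable residue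
extension and residue characteristic `p` (`p ∈ 𝔔`), `I = G_0 = I(𝔔)` its inertia group and `G_i`
its ramification groups.  Assume Brauer's induction theorem (`hBr`), the integrality of the
different exponent (`hD`, IV §1 Cor. to Prop. 4) and of `f` on degree-one characters (`hHA`,
VI §2 Cor. to Prop. 5) for `L/K` at `𝔔`, and Artin's theorem over finite coefficient fields of
characteristic `≠ p` for this inertia group (`hfin`, Katz 1.9 / *LinRep* 19.3; only required when
`A` has prime characteristic `ℓ`, so it is vacuous for `char A = 0`).  Then for every
representation `τ` of `G_0` on a finite-dimensional vector space over a field `A` with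
`(p : A) ≠ 0`, `f(τ) = Σ_i (g_i/g_0) codim M^{G_i} ∈ ℕ`.  Proof (Serre VI §2 pp. 99–103, Katz 1.9):
`g_0 f(τ) = T := Σ_{i ≤ N} g_i codim M^{G_i}` (`artinExponent_eq_sum_div`); the term `i = 0` is a
multiple of `g_0`, and for `i ≥ 1` the `G_i` are `p`-groups
(`Ideal.isPGroup_ramificationSubgroup_one`), so `codim M^{G_i}` is unchanged under the descent and
change of coefficients of `exists_matrix_model`; in characteristic `0` one passes to `ℂ` (Zariski's
lemma, `IsAlgClosed.lift`) and applies `card_inertia_dvd_sum_of_brauer`; in characteristic `ℓ`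
one passes to a finite field (Zariski's lemma) and applies `hfin`.
Ref: Serre, *Local Fields*, Ch. VI §2, Thm 1' and its proof; Katz (1988), Ch. 1, Prop. 1.9.
[cite: SerreLocalFields1979, Ch. VI §2, Thm 1' (proof)] [cite: Katz1988, Ch. 1, Prop. 1.9 (and its proof)] -/
theorem exists_natCast_eq_artinExponent_core (R : Type u) {L : Type*} [CommRing R]
    [IsDedekindDomain R] [Algebra R K] [IsFractionRing R K] [Field L] [Algebra K L]
    [Algebra R L] [IsScalarTower R K L] [FiniteDimensional K L] [IsGalois K L]
    (𝔔 : Ideal (integralClosure R L)) [𝔔.IsMaximal]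
    [Algebra.IsSeparable (R ⧸ 𝔔.under R) (integralClosure R L ⧸ 𝔔)]
    (I : Subgroup (L ≃ₐ[K] L)) (hI : I = 𝔔.inertia (L ≃ₐ[K] L))
    {p : ℕ} [Fact p.Prime] (hp : (p : integralClosure R L) ∈ 𝔔)
    (hBr : Literature.RepresentationTheory.FiniteGroups.brauer_induction)
    (hD : card_inf_inertia_dvd_finsum_lowerIndex R (K := K) (L := L))
    (hHA : card_inf_inertia_dvd_finsum_card_inf_ramificationSubgroup R (K := K) (L := L))
    {A : Type v} [Field A] {M : Type w} [AddCommGroup M] [Module A M] [FiniteDimensional A M]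
    (τ : Representation A I M) (hchar : (p : A) ≠ 0)
    (hfin : ∀ ℓ : ℕ, ℓ.Prime → CharP A ℓ →
      ∀ (κ : Type v) [Field κ] [Finite κ] (n : ℕ) (τ' : Representation κ I (Fin n → κ)),
      (p : κ) ≠ 0 → ∃ m : ℕ, (m : ℝ) = artinExponent 𝔔 (L ≃ₐ[K] L) I.subtype τ') :
    ∃ n : ℕ, (n : ℝ) = artinExponent 𝔔 (L ≃ₐ[K] L) I.subtype τ := by
  classical
  -- instances
  haveI : IsNoetherianRing (integralClosure R L) :=
    IsIntegralClosure.isNoetherianRing R K L (integralClosure R L)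
  haveI : FaithfulSMul (L ≃ₐ[K] L) (integralClosure R L) := faithfulSMul_algEquiv_integralClosure R
  -- Step 0: `G_i = 1` for `i ≥ N + 1`
  obtain ⟨N, hN⟩ := 𝔔.ramificationSubgroup_eventually_eq_bot_holds (L ≃ₐ[K] L)
    Ideal.IsPrime.ne_top'
  have hN' : ∀ i, N + 1 ≤ i → 𝔔.ramificationSubgroup (L ≃ₐ[K] L) i = ⊥ :=
    fun i hi => hN i ((Nat.le_succ N).trans hi)
  have hIr : 𝔔.inertia (L ≃ₐ[K] L) ≤ (I.subtype).range := by rw [Subgroup.range_subtype, hI]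
  have hI0 : (0 : ℝ) < Nat.card I := Nat.cast_pos.mpr Nat.card_pos
  -- Step 1: `f(τ) = T / g_0`, and it suffices that `g_0 ∣ T`
  rw [artinExponent_eq_sum_div 𝔔 (L ≃ₐ[K] L) I.subtype Subtype.val_injective τ hN', ← hI]
  obtain ⟨c, hc⟩ : ∃ c : ℕ → ℕ, ∀ i,
      Representation.codimFixed τ ((𝔔.ramificationSubgroup (L ≃ₐ[K] L) i).comap I.subtype) = c i :=
    ⟨_, fun _ => rfl⟩
  simp only [hc]
  suffices hdvd : Nat.card I ∣
      ∑ i ∈ range (N + 1), Nat.card (𝔔.ramificationSubgroup (L ≃ₐ[K] L) i) * c i by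
    obtain ⟨n, hn⟩ := hdvd
    exact ⟨n, by rw [hn, Nat.cast_mul, mul_div_cancel_left₀ _ hI0.ne']⟩
  -- Step 2: the `G_i`, `i ≥ 1`, are `p`-groups, so `|G_i| ≠ 0` in `A`
  have hP1 : IsPGroup p (𝔔.ramificationSubgroup (L ≃ₐ[K] L) 1) :=
    Ideal.isPGroup_ramificationSubgroup_one 𝔔 (L ≃ₐ[K] L) Ideal.IsPrime.ne_top' hp
  have hcardA : ∀ i, (Nat.card (𝔔.ramificationSubgroup (L ≃ₐ[K] L) (i + 1)) : A) ≠ 0 := by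
    intro i
    obtain ⟨a, ha⟩ := (hP1.to_le (𝔔.ramificationSubgroup_antitone (L ≃ₐ[K] L)
        (Nat.succ_le_succ (Nat.zero_le i)))).exists_card_eq
    rw [ha, Nat.cast_pow]
    exact pow_ne_zero _ hchar
  -- Step 3: reduction to the wild part `S = Σ_{1 ≤ i ≤ N} g_i c_i`
  have key : ∀ (c' : ℕ → ℕ), (∀ i ∈ range N, c' (i + 1) = c (i + 1)) →
      Nat.card I ∣ ∑ i ∈ range (N + 1), Nat.card (𝔔.ramificationSubgroup (L ≃ₐ[K] L) i) * c' i →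
      Nat.card I ∣ ∑ i ∈ range (N + 1), Nat.card (𝔔.ramificationSubgroup (L ≃ₐ[K] L) i) * c i := by
    intro c' hc' hdvd
    rw [Finset.sum_range_succ'] at hdvd ⊢
    have hG0 : Nat.card (𝔔.ramificationSubgroup (L ≃ₐ[K] L) 0) = Nat.card I := by
      rw [𝔔.ramificationSubgroup_zero, ← hI]
    rw [hG0] at hdvd ⊢
    have hS : ∑ i ∈ range N, Nat.card (𝔔.ramificationSubgroup (L ≃ₐ[K] L) (i + 1)) * c' (i + 1) =
        ∑ i ∈ range N, Nat.card (𝔔.ramificationSubgroup (L ≃ₐ[K] L) (i + 1)) * c (i + 1) :=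
      Finset.sum_congr rfl fun i hi => by rw [hc' i hi]
    rw [hS] at hdvd
    exact (Nat.dvd_add_left (dvd_mul_right _ _)).mpr
      ((Nat.dvd_add_left (dvd_mul_right _ _)).mp hdvd)
  -- Step 4: the two coefficient changes
  obtain ⟨ℓ, hℓ⟩ := CharP.exists A
  rcases CharP.char_is_prime_or_zero A ℓ with hℓp | hℓ0
  · -- characteristic `ℓ`: pass to a finite field and use `hfin`
    haveI := Fact.mk hℓp
    letI : Algebra (ZMod ℓ) A := ZMod.algebra A ℓ
    obtain ⟨A₀, hft, τ₀, hmodel⟩ := exists_matrix_model (F₀ := ZMod ℓ) τ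
    obtain ⟨κ, _, _, _, ⟨g⟩⟩ := exists_ringHom_finite A₀
    have hpk : (p : κ) ≠ 0 := by
      intro h0
      rw [CharP.cast_eq_zero_iff κ ℓ p] at h0
      exact hchar ((CharP.cast_eq_zero_iff A ℓ p).mpr h0)
    let τk : Representation κ I (Fin (finrank A M) → κ) :=
      (Matrix.toLinAlgEquiv' (R := κ) (n := Fin (finrank A M))).toRingEquiv.toMonoidHom.comp
        ((g.mapMatrix).toMonoidHom.comp τ₀)
    obtain ⟨m', hm'⟩ := hfin ℓ hℓp hℓ κ (finrank A M) τk hpk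
    rw [artinExponent_eq_sum_div 𝔔 (L ≃ₐ[K] L) I.subtype Subtype.val_injective τk hN', ← hI,
      eq_div_iff hI0.ne', mul_comm] at hm'
    refine key (fun i => Representation.codimFixed τk
        ((𝔔.ramificationSubgroup (L ≃ₐ[K] L) i).comap I.subtype)) (fun i _ => ?_)
      ⟨m', by exact_mod_cast hm'.symm⟩
    have h2 := (hmodel g ((𝔔.ramificationSubgroup (L ≃ₐ[K] L) (i + 1)).comap I.subtype)
      (by rw [card_comap_ramificationSubgroup 𝔔 (L ≃ₐ[K] L) I.subtype Subtype.val_injective hIr]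
          exact hcardA i)).2
    rw [← hc, Representation.codimFixed_eq_finrank_sub, Representation.codimFixed_eq_finrank_sub, h2,
      Module.finrank_fin_fun]
  · -- characteristic `0`: pass to `ℂ` and use `card_inertia_dvd_sum_of_brauer`
    haveI : CharZero A := (CharP.charP_zero_iff_charZero A).mp (hℓ0 ▸ hℓ)
    obtain ⟨A₀, hft, τ₀, hmodel⟩ := exists_matrix_model (F₀ := ℚ) τ
    obtain ⟨g⟩ := nonempty_ringHom_complex A₀
    let τC : Representation ℂ I (Fin (finrank A M) → ℂ) :=
      (Matrix.toLinAlgEquiv' (R := ℂ) (n := Fin (finrank A M))).toRingEquiv.toMonoidHom.comp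
        ((g.mapMatrix).toMonoidHom.comp τ₀)
    refine key (fun i => Representation.codimFixed τC
        ((𝔔.ramificationSubgroup (L ≃ₐ[K] L) i).comap I.subtype)) (fun i _ => ?_)
      (card_inertia_dvd_sum_of_brauer R 𝔔 I hI hN' hBr hD hHA τC)
    have h2 := (hmodel g ((𝔔.ramificationSubgroup (L ≃ₐ[K] L) (i + 1)).comap I.subtype)
      (by rw [card_comap_ramificationSubgroup 𝔔 (L ≃ₐ[K] L) I.subtype Subtype.val_injective hIr]
          exact Nat.cast_ne_zero.mpr Nat.card_pos.ne')).2
    rw [← hc, Representation.codimFixed_eq_finrank_sub, Representation.codimFixed_eq_finrank_sub,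
      h2, Module.finrank_fin_fun]

end Core

end Literature.NumberTheory.GaloisRepresentations

/-! ## Artin's theorem at a prime of a number field: `exists_natCast_eq_artinExponent` from the
named facts -/

namespace Literature.NumberTheory.GaloisRepresentations

open Module IsDedekindDomain
open scoped NumberField

universe u v w

variable {K : Type u} [Field K] {A : Type v} [Field A] {M : Type w} [AddCommGroup M] [Module A M]

/-- **Artin's integrality theorem for the inertia group at a prime of a number field** — the
named fact `Literature.NumberTheory.GaloisRepresentations.exists_natCast_eq_artinExponent` of `ArtinConductorIntegrality` (Serre VI §2
Thm 1' with Cor. 1'; Katz 1.9) — **follows from**: Brauer's induction theorem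
(`Literature.RepresentationTheory.FiniteGroups.brauer_induction`, Serre *LinRep* §10 Thm 20), the integrality of the different
exponent (`card_inf_inertia_dvd_finsum_lowerIndex`, IV §1 Cor. to Prop. 4) and of `f` on
degree-one characters (`card_inf_inertia_dvd_finsum_card_inf_ramificationSubgroup`, VI §2 Cor. to
Prop. 5, i.e. Hasse–Arf) for the finite layers of `K̄/K` (hypotheses quantified over the
coefficient ring `R` of `K`, as a discharge `…_holds` provides them), and Artin's theorem over
finite coefficient fields (`exists_natCast_eq_artinExponent_finiteField`, Katz 1.9 with
`A = 𝔽_λ`, needed only when `char A = ℓ > 0`).  The residue characteristic `p` of `v` satisfies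
`q_v = p^f`, so `(q_v : A) ≠ 0` gives `(p : A) ≠ 0`, and `exists_natCast_eq_artinExponent_core`
applies at `R = 𝓞 K`, `L = E`, `𝔔 = 𝔓 ∩ E` (maximal, with finite hence perfect residue field).
Ref: Serre, *Local Fields*, Ch. VI §2, Thm 1' and its proof (p. 103); Katz (1988), Ch. 1,
Prop. 1.9. [cite: SerreLocalFields1979, Ch. VI §2, Thm 1' (proof)]
[cite: Katz1988, Ch. 1, Prop. 1.9 (and its proof)] -/
theorem exists_natCast_eq_artinExponent_of
    (hBr : Literature.RepresentationTheory.FiniteGroups.brauer_induction)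
    (hD : ∀ (R : Type u) [CommRing R] [Algebra R K] (E : IntermediateField K (AlgebraicClosure K)),
      card_inf_inertia_dvd_finsum_lowerIndex R (K := K) (L := E))
    (hHA : ∀ (R : Type u) [CommRing R] [Algebra R K] (E : IntermediateField K (AlgebraicClosure K)),
      card_inf_inertia_dvd_finsum_card_inf_ramificationSubgroup R (K := K) (L := E))
    (hfin : ∀ {A' : Type v} [Field A'] {M' : Type v} [AddCommGroup M'] [Module A' M'],
      exists_natCast_eq_artinExponent_finiteField (K := K) (A := A') (M := M')) :
    exists_natCast_eq_artinExponent (K := K) (A := A) (M := M) := by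
  intro _ _ v 𝔓 h𝔓 E _ _ τ hchar
  classical
  haveI : 𝔓.IsMaximal := HeightOneSpectrum.isMaximal_of_mem_primesAbove h𝔓
  haveI : Finite (𝓞 K ⧸ 𝔓.under (𝓞 K)) := by
    rw [← h𝔓.2.over]
    exact Ideal.finiteQuotientOfFreeOfNeBot v.asIdeal v.ne_bot
  haveI : Algebra.IsSeparable K E := Algebra.IsSeparable.of_integral K E
  haveI : IsGalois K E := {}
  haveI := isMaximal_comap_integralClosureToAbsIntegers (𝓞 K) 𝔓 E
  haveI := isSeparable_residue_comap (𝓞 K) 𝔓 E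
  -- the residue characteristic `p` of `v`: `q_v = p ^ f`
  haveI : Finite (𝓞 K ⧸ v.asIdeal) := Ideal.finiteQuotientOfFreeOfNeBot v.asIdeal v.ne_bot
  letI : Fintype (𝓞 K ⧸ v.asIdeal) := Fintype.ofFinite _
  letI : Field (𝓞 K ⧸ v.asIdeal) := Ideal.Quotient.field _
  obtain ⟨n, hpprime, hcard⟩ := FiniteField.card (𝓞 K ⧸ v.asIdeal) (ringChar (𝓞 K ⧸ v.asIdeal))
  haveI := Fact.mk hpprime
  have hpv : ((ringChar (𝓞 K ⧸ v.asIdeal) : ℕ) : 𝓞 K) ∈ v.asIdeal := by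
    rw [← Ideal.Quotient.eq_zero_iff_mem, map_natCast]
    exact ringChar.Nat.cast_ringChar
  have hp𝔓 : ((ringChar (𝓞 K ⧸ v.asIdeal) : ℕ) : integralClosure (𝓞 K) E) ∈
      𝔓.comap (E.integralClosureToAbsIntegers (𝓞 K)) := by
    set ι := E.integralClosureToAbsIntegers (𝓞 K) with hι
    have h2 : ι ((ringChar (𝓞 K ⧸ v.asIdeal) : ℕ) : integralClosure (𝓞 K) E) =
        ((ringChar (𝓞 K ⧸ v.asIdeal) : ℕ) : absIntegers (𝓞 K) K) := map_natCast ι _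
    have h3 : ((ringChar (𝓞 K ⧸ v.asIdeal) : ℕ) : absIntegers (𝓞 K) K) =
        algebraMap (𝓞 K) (absIntegers (𝓞 K) K) (ringChar (𝓞 K ⧸ v.asIdeal)) :=
      (map_natCast _ _).symm
    have h4 : ((ringChar (𝓞 K ⧸ v.asIdeal) : ℕ) : 𝓞 K) ∈ 𝔓.under (𝓞 K) := by
      rw [← h𝔓.2.over]
      exact hpv
    show ι _ ∈ 𝔓
    rw [h2, h3]
    exact h4
  have hq : v.residueCard = ringChar (𝓞 K ⧸ v.asIdeal) ^ (n : ℕ) := by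
    rw [HeightOneSpectrum.residueCard_eq_card_quotient, Nat.card_eq_fintype_card, hcard]
  have hpA : ((ringChar (𝓞 K ⧸ v.asIdeal) : ℕ) : A) ≠ 0 := fun h0 =>
    hchar (by rw [hq, Nat.cast_pow, h0, zero_pow n.ne_zero])
  refine exists_natCast_eq_artinExponent_core (𝓞 K) (𝔓.comap (E.integralClosureToAbsIntegers (𝓞 K)))
    _ rfl hp𝔓 hBr (hD (𝓞 K) E) (hHA (𝓞 K) E) τ hpA ?_
  intro _ _ _ κ _ _ n' τ' hpκ
  have hqκ : (v.residueCard : κ) ≠ 0 := by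
    rw [hq, Nat.cast_pow]
    exact pow_ne_zero _ hpκ
  exact hfin h𝔓 E τ' hqκ

/-- **Characteristic-`0` coefficients: Artin's theorem for the inertia group from three named
facts.**  For a coefficient field `A` of characteristic `0` (e.g. `ℂ`, `ℚ̄_ℓ`, `E_λ`), the named fact
`exists_natCast_eq_artinExponent (A := A)` follows from Brauer's induction theorem and the two
arithmetic inputs alone (the finite-field case is not needed): Serre's Theorem 1' with its printed
proof, VI §2 p. 103.
[cite: SerreLocalFields1979, Ch. VI §2, Thm 1' (proof)] -/
theorem exists_natCast_eq_artinExponent_of_charZero [CharZero A]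
    (hBr : Literature.RepresentationTheory.FiniteGroups.brauer_induction)
    (hD : ∀ (R : Type u) [CommRing R] [Algebra R K] (E : IntermediateField K (AlgebraicClosure K)),
      card_inf_inertia_dvd_finsum_lowerIndex R (K := K) (L := E))
    (hHA : ∀ (R : Type u) [CommRing R] [Algebra R K] (E : IntermediateField K (AlgebraicClosure K)),
      card_inf_inertia_dvd_finsum_card_inf_ramificationSubgroup R (K := K) (L := E)) :
    exists_natCast_eq_artinExponent (K := K) (A := A) (M := M) := by
  intro _ _ v 𝔓 h𝔓 E _ _ τ hchar
  classical
  haveI : 𝔓.IsMaximal := HeightOneSpectrum.isMaximal_of_mem_primesAbove h𝔓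
  haveI : Finite (𝓞 K ⧸ 𝔓.under (𝓞 K)) := by
    rw [← h𝔓.2.over]
    exact Ideal.finiteQuotientOfFreeOfNeBot v.asIdeal v.ne_bot
  haveI : Algebra.IsSeparable K E := Algebra.IsSeparable.of_integral K E
  haveI : IsGalois K E := {}
  haveI := isMaximal_comap_integralClosureToAbsIntegers (𝓞 K) 𝔓 E
  haveI := isSeparable_residue_comap (𝓞 K) 𝔓 E
  -- the residue characteristic `p` of `v`
  haveI : Finite (𝓞 K ⧸ v.asIdeal) := Ideal.finiteQuotientOfFreeOfNeBot v.asIdeal v.ne_bot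
  letI : Fintype (𝓞 K ⧸ v.asIdeal) := Fintype.ofFinite _
  letI : Field (𝓞 K ⧸ v.asIdeal) := Ideal.Quotient.field _
  obtain ⟨n, hpprime, hcard⟩ := FiniteField.card (𝓞 K ⧸ v.asIdeal) (ringChar (𝓞 K ⧸ v.asIdeal))
  haveI := Fact.mk hpprime
  have hpv : ((ringChar (𝓞 K ⧸ v.asIdeal) : ℕ) : 𝓞 K) ∈ v.asIdeal := by
    rw [← Ideal.Quotient.eq_zero_iff_mem, map_natCast]
    exact ringChar.Nat.cast_ringChar
  have hp𝔓 : ((ringChar (𝓞 K ⧸ v.asIdeal) : ℕ) : integralClosure (𝓞 K) E) ∈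
      𝔓.comap (E.integralClosureToAbsIntegers (𝓞 K)) := by
    set ι := E.integralClosureToAbsIntegers (𝓞 K) with hι
    have h2 : ι ((ringChar (𝓞 K ⧸ v.asIdeal) : ℕ) : integralClosure (𝓞 K) E) =
        ((ringChar (𝓞 K ⧸ v.asIdeal) : ℕ) : absIntegers (𝓞 K) K) := map_natCast ι _
    have h3 : ((ringChar (𝓞 K ⧸ v.asIdeal) : ℕ) : absIntegers (𝓞 K) K) =
        algebraMap (𝓞 K) (absIntegers (𝓞 K) K) (ringChar (𝓞 K ⧸ v.asIdeal)) :=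
      (map_natCast _ _).symm
    have h4 : ((ringChar (𝓞 K ⧸ v.asIdeal) : ℕ) : 𝓞 K) ∈ 𝔓.under (𝓞 K) := by
      rw [← h𝔓.2.over]
      exact hpv
    show ι _ ∈ 𝔓
    rw [h2, h3]
    exact h4
  have hpA : ((ringChar (𝓞 K ⧸ v.asIdeal) : ℕ) : A) ≠ 0 :=
    Nat.cast_ne_zero.mpr hpprime.ne_zero
  refine exists_natCast_eq_artinExponent_core (𝓞 K) (𝔓.comap (E.integralClosureToAbsIntegers (𝓞 K)))
    _ rfl hp𝔓 hBr (hD (𝓞 K) E) (hHA (𝓞 K) E) τ hpA ?_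
  intro ℓ hℓ hℓA
  exact absurd (CharP.eq A hℓA (CharP.ofCharZero A)) hℓ.ne_zero

/-- **The corrected Artin–Katz integrality statement from named facts of the printed theory.**
`Literature.NumberTheory.GaloisRepresentations.GaloisRep.exists_natCast_eq_artinConductorAt_of_hasOpenInertiaKerAt` (`ArtinConductor.lean`;
the faithful form of the mis-stated `exists_natCast_eq_artinConductorAt` [Katz1988, Prop. 1.9])
follows from: Herbrand's theorem at the finite layers (`herbrand_quotient`, Serre IV §3 Prop. 14),
Brauer's induction theorem (*LinRep* §10), the integrality of the different exponent (IV §1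
Cor. to Prop. 4), the integrality of `f` on degree-one characters (VI §2 Cor. to Prop. 5, i.e.
Hasse–Arf), and — for coefficient fields of positive characteristic only — Artin's theorem over
finite fields (Katz 1.9, `A = 𝔽_λ`; *LinRep* 19.3).  Composition of
`GaloisRep.exists_natCast_eq_artinConductorAt_of_hasOpenInertiaKerAt_of_herbrand_quotient`
(`ArtinConductorIntegralityProofs`) with `exists_natCast_eq_artinExponent_of`.
[cite: Katz1988, Ch. 1, Prop. 1.9 (and its proof)] [cite: SerreLocalFields1979, Ch. VI §2, Thm 1' (proof)] -/
theorem GaloisRep.exists_natCast_eq_artinConductorAt_of_hasOpenInertiaKerAt_of_brauer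
    [TopologicalSpace A] [TopologicalSpace M]
    (hq : ∀ (R : Type u) [CommRing R] [Algebra R K] {E E' : IntermediateField K (AlgebraicClosure K)}
      (hle : E ≤ E'), herbrand_quotient R (IntermediateField.restrict hle))
    (hBr : Literature.RepresentationTheory.FiniteGroups.brauer_induction)
    (hD : ∀ (R : Type u) [CommRing R] [Algebra R K] (E : IntermediateField K (AlgebraicClosure K)),
      card_inf_inertia_dvd_finsum_lowerIndex R (K := K) (L := E))
    (hHA : ∀ (R : Type u) [CommRing R] [Algebra R K] (E : IntermediateField K (AlgebraicClosure K)),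
      card_inf_inertia_dvd_finsum_card_inf_ramificationSubgroup R (K := K) (L := E))
    (hfin : ∀ {A' : Type v} [Field A'] {M' : Type v} [AddCommGroup M'] [Module A' M'],
      exists_natCast_eq_artinExponent_finiteField (K := K) (A := A') (M := M')) :
    GaloisRep.exists_natCast_eq_artinConductorAt_of_hasOpenInertiaKerAt.{u, v, w}
      (K := K) (A := A) (M := M) :=
  GaloisRep.exists_natCast_eq_artinConductorAt_of_hasOpenInertiaKerAt_of_herbrand_quotient hq
    (exists_natCast_eq_artinExponent_of hBr hD hHA hfin)

/-- **Characteristic-`0` coefficients: the corrected Artin–Katz integrality statement from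
Herbrand's theorem, Brauer's theorem and the two arithmetic inputs** (no finite-field input).
[cite: Katz1988, Ch. 1, Prop. 1.9 (and its proof)] [cite: SerreLocalFields1979, Ch. VI §2, Thm 1' (proof)] -/
theorem GaloisRep.exists_natCast_eq_artinConductorAt_of_hasOpenInertiaKerAt_of_brauer_charZero
    [CharZero A] [TopologicalSpace A] [TopologicalSpace M]
    (hq : ∀ (R : Type u) [CommRing R] [Algebra R K] {E E' : IntermediateField K (AlgebraicClosure K)}
      (hle : E ≤ E'), herbrand_quotient R (IntermediateField.restrict hle))
    (hBr : Literature.RepresentationTheory.FiniteGroups.brauer_induction)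
    (hD : ∀ (R : Type u) [CommRing R] [Algebra R K] (E : IntermediateField K (AlgebraicClosure K)),
      card_inf_inertia_dvd_finsum_lowerIndex R (K := K) (L := E))
    (hHA : ∀ (R : Type u) [CommRing R] [Algebra R K] (E : IntermediateField K (AlgebraicClosure K)),
      card_inf_inertia_dvd_finsum_card_inf_ramificationSubgroup R (K := K) (L := E)) :
    GaloisRep.exists_natCast_eq_artinConductorAt_of_hasOpenInertiaKerAt.{u, v, w}
      (K := K) (A := A) (M := M) :=
  GaloisRep.exists_natCast_eq_artinConductorAt_of_hasOpenInertiaKerAt_of_herbrand_quotient hq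
    (exists_natCast_eq_artinExponent_of_charZero hBr hD hHA)

end Literature.NumberTheory.GaloisRepresentations

end
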